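import Literature.Geometry.Kaehler.ComplexTorusPolarizationFlatDegrees
import Literature.Geometry.Kaehler.ComplexTorusSemipositiveIntersection
import Literature.Geometry.Kaehler.ComplexTorusHodgeClassesEllipticProductKunneth
import Mathlib.GroupTheory.Perm.DomMulAct
import HarnessLib

/-!
# Complementary multidegrees of orthogonal abelian subvarieties: Bertrand's Corollary
# `deg_J(B)/r₁!⋯r_n! = deg_{J′}(B^⊥)/r′₁!⋯r′_n!` on forms, for all cycles and all types (Bertrand 1997, §3 (b))

Layer `Literature/Geometry/Kaehler`, namespace `Literature.Geometry.Kaehler.ComplexTorus`; lane `lit-hodgefound`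
(Track 2 foundations library), Layer A4 (cycle classes and degrees on abelian varieties), prover seat p09 (gen 15).
Sequel of `ComplexTorusPolarizationFlatDegrees.lean` (gen 12: the ONE-BLOCK case
`q! ∫_X c₁(L)^{∧p} ∧ η♭(σ) = (d₁⋯d_g) p! ∫_σ c₁(L)^{∧q}`, i.e. Bertrand's §3 (a) "`deg_λ(B)/b! = deg_λ(B^⊥)/b'!`" on forms),
of `ComplexTorusPolarizationFlatFourier.lean` (`η♭ ∘ P⁻¹ = ± φ_L^* ∘ F`, Prop. 6.2.20 + Lemma 1.4.5), of
`ComplexTorusBeauvilleFourierPolarizationGeneral.lean` (prover p16: `F(dx_{T-pairs}) = (-1)^p dx̂_{Tᶜ-pairs}`,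
`φ_L^* dx̂_{S-pairs} = (∏_S d²) dx_{S-pairs}`), of `ComplexTorusPoincareFormula.lean` (symplectic enumerations
`IsSymplecticEnum Φ e₀ η d`, interleaved words `ilvWord`, Thm. 2.5.16 in cohomological form `wedgePow_eq_sum`), of
`ComplexTorusSemipositiveIntersection.lean` (`wedgeFamily_sum_smul`: multilinear expansion of `θ₀ ∧ ⋯ ∧ θ_{q-1}`) and of
`ComplexTorusHodgeClassesEllipticProductKunneth.lean` (`wedgeFamily_comp_perm`: the factors commute) — all consumed BY
NAME — on the carriers `H_k(X, ℤ) = ⋀^k Λ` (`∫_σ = cycleIntegral`), `Hᵏ(X, ℂ) = Alt^k_ℝ(E; ℂ)` (`∫_X = torusIntegral Φ e`),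
`P = cyclePoincareDualEquiv Φ e`, `η♭ = polFlat Φ η`, for a complex torus `X = E/ΦΛ` presented by a SYMPLECTIC lattice
basis `(λ_ν, μ_ν)_{ν < g}` of type `(d₁, …, d_g)` for the polarisation `η` (`E = ofRealForm η`, `c₁(L) = -E`).

## Source (verbatim) and dictionary

D. Bertrand, *Duality on tori and multiplicative dependence relations*, J. Austral. Math. Soc. (Series A) **62**
(1997) 198–216 [cite: Bertrand1997DualityTori], held copy `paper:doi-10-1017-s1446788700000768`, §3 (b)
"Complementary multidegrees" (chunk p0016 L46 – p0018 L12):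

"We here suppose that `A` is the product of `n` polarized abelian varieties `(C₁, λ₁), …, (C_n, λ_n)`, and that
`λ = p₁^*λ₁ + ⋯ + p_n^*λ_n`, where `p_i` is the projection from `A` to `C_i`. Denote by `c_i` the dimension of `C_i`,
so that `a = dim A = c₁ + ⋯ + c_n`, and let `J = {r₁, …, r_n}` be a set of integers such that `0 ≤ r_i ≤ c_i` for
`i = 1, …, n`. In particular, `b := r₁ + ⋯ + r_n ≤ a`. For any subvariety `W` of `A`, of dimension `b`, we may then
consider the intersection number `deg_J(W) = (W · p₁^*λ₁^{r₁} ⋯ p_n^*λ_n^{r_n})`. […] The relation between `deg_λ(W)`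
and the different multidegrees of `W` is given by Newton's formula: `deg_λ(W) = Σ_J c(J) deg_J(W)`, where `J` runs
through all sets of `n`-tuples `{r₁, …, r_n}` as above, and `c(J)` is the binomial coefficient `b!/r₁!⋯r_n!`. […]
For each `J = {r₁, …, r_n}`, we denote the 'complementary' set of `J` by `J′ = {r′₁ = c₁ - r₁, …, r′_n = c_n - r_n}`,
with `r′₁ + ⋯ + r′_n := b′ = a - b`.
COROLLARY. Let `(A, λ) = ∏_{i=1}^n (C_i, λ_i)` be a principally polarized abelian variety, let `B`, `B^⊥` be a pair
of orthogonal abelian subvarieties with respect to `λ`, of dimension `b`, `b′ = a - b`, and let `J`, `J′` be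
complementary sets of indices as above. Then, `deg_J(B)/r₁!⋯r_n! = deg_{J′}(B^⊥)/r′₁!⋯r′_n!`."

Bertrand's proof applies Theorem 3 to the one-parameter family of polarisations `λ_z = Σ zᵢ pᵢ^*λᵢ` and compares
coefficients of a polynomial identity in `z`. Here the statement is proved on FORMS, for ALL cycles and ALL types,
by the cohomological computation of gen 12 refined from powers of `E` to monomials in the blocks:

* A PRODUCT `(A, λ) = ∏ (Cᵢ, λᵢ)` presented by a product symplectic basis is a torus with a symplectic enumeration
  `e₀` of type `d` (tree `IsSymplecticEnum Φ e₀ η d`) whose pairs `(λ_ν, μ_ν)` are distributed into blocks by a map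
  `blk : Fin g → β` (block `i` = the pairs coming from `Cᵢ`, `#blk⁻¹ i = cᵢ = dim Cᵢ`); then
  `p_i^*E_i = θ_i := Σ_{blk ν = i} d_ν dx_ν ∧ dx_{g+ν}` (`blockTwoForm`; `Σ_i θ_i = E`, `IsSymplecticEnum.sum_blockTwoForm_eq_ofRealForm`)
  and `c₁(p_i^*L_i) = -θ_i`. §1–§6 are stated for an ARBITRARY polarised torus with a symplectic basis and an
  arbitrary block map (the statements only see the blocks); §7 constructs the instance for the tree's binary
  product `prodPeriod Φ₁ Φ₂`, `prodForm η₁ η₂ = p₁^*η₁ + p₂^*η₂` (`IsSymplecticEnum.prod`: concatenated symplectic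
  bases; `IsSymplecticEnum.blockTwoForm_prod_false/true`: `θ_{false} = p₁^*E₁`, `θ_{true} = p₂^*E₂`;
  `card_filter_prodBlock_false/true`: block sizes `g₁`, `g₂`) and specialises the Corollary to it
  (`IsSymplecticEnum.prod_factorial_mul_torusIntegral_chern_wedge_polFlat_prod`); `n` factors by iteration.
* `p₁^*λ₁^{r₁} ⋯ p_n^*λ_n^{r_n}` is the block monomial `θ^c := θ_{c 0} ∧ ⋯ ∧ θ_{c (q-1)}` (`blockPow`, an iterated
  `wedgeFamily`) of any WORD `c : Fin q → β` with multiplicities `J(c) = (r_i = #c⁻¹ i)` (`wordMult`) — independent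
  of the order of the letters (`blockPow_comp_perm`); `deg_J(W) = ∫_{[W]} θ^{c}` up to the sign `(-1)^q` of
  `c₁ = -θ` (tree `cycleIntegral`, `ComplexTorusSubtorusDegree`: `(L₁ ⋯ L_d · Y) = ∫_X c₁(L₁) ∧ ⋯ ∧ c₁(L_d) ∧ [Y]`).
* "`J`, `J′` complementary" = `r_i(c) + r_i(c′) = #blk⁻¹ i` for all `i` (hypothesis `hcc'`).
* `B^⊥` enters through `η♭([B]) = cl(B^⊥)` (gen 11, `IsPrincipalPolarization.torusIntegral_wedge_polFlat_eq_cycleIntegral`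
  in `ComplexTorusComplementarySubtorusClassDuality`: `∫_X θ ∧ η♭([Y]) = ∫_{[Y^⊥]} θ`), so that for `σ = [B]`,
  `∫_X θ^{c′} ∧ η♭(σ) = deg_{J′}(B^⊥)` and `∫_σ θ^{c} = deg_J(B)`; the theorems below hold for EVERY `σ ∈ H_{2q}(X, ℤ)`.

## What is proved (definitions with bodies `pairMonomial`, `blockTwoForm`, `blockPow`, `wordMult`; theorems; NO named fact)

* §0–§1 vocabulary; `wedgeFamily_pairMonomial` (`ω_{f 0} ∧ ⋯ ∧ ω_{f(q-1)} = dx_{f-pairs}`, `ω_ν = dx_ν ∧ dx_{g+ν}`),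
  vanishing on words with a repeated letter, invariance under permutations of the letters.
* §2 `card_perm_comp_eq`: `#{π ∈ 𝔖_q | u ∘ π = c} = ∏_i r_i(c)!` if `u`, `c` have the same multiplicities, else `0`
  (Mathlib `DomMulAct.stabilizer_card` + `Equiv.ofFiberEquiv`); §6 `card_filter_wordMult_eq_mul`:
  `#{c′ | J(c′) = J(c)} · ∏ r_i! = b!` — Bertrand's `c(J) = b!/r₁!⋯r_n!`.
* §3 **`blockPow_eq_sum`** — the expansion
  `θ^{c} = (∏_i r_i!) Σ_{#T = q, #(T ∩ blk⁻¹ i) = r_i} (∏_{ν∈T} d_ν) dx_{T-pairs}` (the one-block case is the tree's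
  Thm. 2.5.16 `E^{∧q} = q! Σ_T (∏_T d_ν) dx_{T-pairs}`), through `sum_filter_injective_eq_sum_sum_perm` (injective
  words = (support, ordering)).
* §4 **`IsSymplecticEnum.fourierForm_blockPow_compContinuousLinearMap_realRep`**
  (`φ_L^* F(θ^{c′}) = (-1)^p (J′!/J!) (d₁⋯d_g) θ^{c}`) and
  **`IsSymplecticEnum.polFlat_cyclePoincareDualEquiv_symm_blockPow`**:
  **`η♭(P⁻¹ θ^{c′}) = (-1)^{p+q} (J′!/J!) (d₁⋯d_g) · θ^{c}`** (`p + q = g`, complementary multiplicities).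
* §5 **`IsSymplecticEnum.torusIntegral_blockPow_wedge_polFlat`** (`∫_X θ^{c′} ∧ η♭(σ) = ± (J′!/J!)(d₁⋯d_g) ∫_σ θ^{c}`),
  **`IsSymplecticEnum.prod_factorial_mul_torusIntegral_chern_wedge_polFlat`**:
  **`J! · ∫_X ch^{J′} ∧ η♭(σ) = (d₁⋯d_g) · J′! · ∫_σ ch^{J}`** for every `σ ∈ H_{2q}(X, ℤ)` (`ch_i = -θ_i = c₁(p_i^*L_i)`),
  and the PRINCIPAL case **`J! ∫_X θ^{J′} ∧ η♭(σ) = J′! ∫_σ θ^{J}`** (`…_of_principal`) — the Corollary as printed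
  for `σ = [B]`, and for every integral cycle.
* §6 `IsSymplecticEnum.sum_blockTwoForm_eq_ofRealForm` (`Σ_i θ_i = E`), **Newton's formula in word form**
  `IsSymplecticEnum.wedgePow_eq_sum_blockPow` (`E^{∧b} = Σ_{c : Fin b → β} θ^{c}`; grouped by multiplicity classes of
  size `c(J)` this is `deg_λ(W) = Σ_J c(J) deg_J(W)`).

* §7 the binary product: `prodEnum` (concatenated enumeration), `prodBlock : Fin (g₁ + g₂) → Bool`,
  `IsSymplecticEnum.prod` / `prod_of_principal`, `prodPeriod_single_inl/inr`, `coord_prodPeriod_inl/inr`,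
  `latMonomial_ilvWord_compContinuousLinearMap_fst/snd` (`p₁^* dx¹_{T-pairs} = dx_{T-pairs}`),
  `IsSymplecticEnum.blockTwoForm_prod_false/true` (`θ = p₁^*E₁`, `p₂^*E₂`), and
  **`IsSymplecticEnum.prod_factorial_mul_torusIntegral_chern_wedge_polFlat_prod`** — the Corollary for
  `(X₁ × X₂, p₁^*η₁ + p₂^*η₂)` with principal factors, every `σ ∈ H_{2q}(X₁ × X₂, ℤ)`.

Not here: the subvariety reading `σ = [B]` (one line from gen 11's
`IsPrincipalPolarization.torusIntegral_wedge_polFlat_eq_cycleIntegral` once `[B]` is placed in degree `2q`), and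
`n ≥ 3` factors as an explicit iterated product (the block statements cover any number of blocks).

## References

* [cite: Bertrand1997DualityTori] D. Bertrand, Duality on tori and multiplicative dependence relations, J. Austral.
  Math. Soc. Ser. A 62 (1997), §3 (b) (pp. 213–215: `deg_J`, Newton's formula, the Corollary and its proof).
* [cite: Lange2023AbelianVarietiesComplex] H. Lange, Abelian Varieties over the Complex Numbers (2023), §2.5.3
  Lemma 2.5.14, Thm. 2.5.16; §6.2.4 Prop. 6.2.20; §6.3.2 Thm. 6.3.5; §1.4.2 Lemma 1.4.5, Prop. 1.4.6 (c); §1.7.2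
  Lemma 1.7.4.
* [cite: Bona2011] M. Bóna, A Walk Through Combinatorics (3rd ed., 2011), §3.1 Thm. 3.5 (linear orderings of a
  multiset: `n!/(a₁!⋯a_k!)`).
-/

noncomputable section

open scoped Matrix
open Module Function Complex Finset
open Literature.LinearAlgebra.Alternating

universe uE

namespace Literature.Geometry.Kaehler

namespace ComplexTorus

/-! ## §0 Vocabulary: pair forms `dx_ν ∧ dy_ν`, block forms `θ_i`, block monomials `θ^c` -/

section Vocabulary

variable {ι : Type*} {E : Type uE} [NormedAddCommGroup E] [NormedSpace ℂ E] (Φ : (ι → ℝ) ≃L[ℝ] E)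
  {g : ℕ} (e₀ : Fin g ⊕ Fin g ≃ ι)

/-- **The pair form `ω_ν = dx_ν ∧ dx_{g+ν}`** (`= dx_ν ∧ dy_ν`) of the `ν`-th symplectic pair `(λ_ν, μ_ν)` of a
lattice basis enumerated by `e₀` — the interleaved lattice monomial of the one-letter word `(ν)` (Lange's
`dx_ν ∧ dx_{g+ν}` in `c₁(L) = -Σ d_ν dx_ν ∧ dx_{g+ν}`, Lemma 1.7.4).
[cite: Lange2023AbelianVarietiesComplex, §1.7.2 Lemma 1.7.4 and §2.5.3 Thm. 2.5.16] -/
def pairMonomial (ν : Fin g) : E [⋀^Fin 2]→L[ℝ] ℂ := latMonomial Φ (2 * 1) (ilvWord e₀ fun _ : Fin 1 ↦ ν)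

/-- Unfolding of `pairMonomial`. [cite: Lange2023AbelianVarietiesComplex, §1.7.2 Lemma 1.7.4] -/
theorem pairMonomial_eq (ν : Fin g) : pairMonomial Φ e₀ ν = latMonomial Φ (2 * 1) (ilvWord e₀ fun _ : Fin 1 ↦ ν) := rfl

variable (d : Fin g → ℕ) {β : Type*} [DecidableEq β] (blk : Fin g → β)

/-- **The block form `θ_i = Σ_{ν : blk ν = i} d_ν · dx_ν ∧ dx_{g+ν}`** of the block `i` of a symplectic lattice basis
of type `d` whose pairs `(λ_ν, μ_ν)` are distributed into blocks by `blk` — in Bertrand's situation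
`(A, λ) = ∏ᵢ (Cᵢ, λᵢ)`, `λ = p₁^*λ₁ + ⋯ + p_n^*λ_n`, presented by a product symplectic basis, block `i` = the pairs
coming from the factor `Cᵢ` and `θ_i = p_i^*E_i` is the pulled-back polarisation form of the `i`-th factor
(`c₁(p_i^*L_i) = -θ_i`); `Σ_i θ_i = E` (`sum_blockTwoForm`).
[cite: Bertrand1997DualityTori, §3 (b) (p. 213: "`λ = p₁^*λ₁ + ⋯ + p_n^*λ_n`, where `p_i` is the projection from `A` to `C_i`")] -/
def blockTwoForm (i : β) : E [⋀^Fin 2]→L[ℝ] ℂ :=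
  ∑ ν, (if blk ν = i then ((d ν : ℕ) : ℂ) else 0) • pairMonomial Φ e₀ ν

/-- **The block monomial `θ^c = θ_{c 0} ∧ ⋯ ∧ θ_{c (q-1)}`** of a word `c : Fin q → β` in the blocks — for a word
with multiplicities `J = (r_i = #c⁻¹(i))` this is Bertrand's `p₁^*λ₁^{r₁} ⋯ p_n^*λ_n^{r_n}` (up to the order of the
factors, immaterial: `blockPow_comp_perm`), whose integral over a `b`-dimensional subvariety `W`
(`b = |J| = q`) is the multidegree `deg_J(W) = (W · p₁^*λ₁^{r₁} ⋯ p_n^*λ_n^{r_n})`.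
[cite: Bertrand1997DualityTori, §3 (b) (p. 214: "`deg_J(W) = (W · p₁^*λ₁^{r₁} ⋯ p_n^*λ_n^{r_n})`")] -/
def blockPow {q : ℕ} (c : Fin q → β) : E [⋀^Fin (2 * q)]→L[ℝ] ℂ :=
  wedgeFamily q fun j ↦ blockTwoForm Φ e₀ d blk (c j)

/-- Unfolding of `blockPow`. [cite: Bertrand1997DualityTori, §3 (b) (p. 214)] -/
theorem blockPow_eq {q : ℕ} (c : Fin q → β) :
    blockPow Φ e₀ d blk c = wedgeFamily q fun j ↦ blockTwoForm Φ e₀ d blk (c j) := rfl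

/-- The block monomial does not depend on the order of the factors (`2`-forms commute).
[cite: Bertrand1997DualityTori, §3 (b) (p. 214)] -/
theorem blockPow_comp_perm {q : ℕ} (c : Fin q → β) (σ : Equiv.Perm (Fin q)) :
    blockPow Φ e₀ d blk (c ∘ σ) = blockPow Φ e₀ d blk c :=
  wedgeFamily_comp_perm q (fun j ↦ blockTwoForm Φ e₀ d blk (c j)) σ

/-- **The multiplicity vector `J = (r_i)` of a word `c`**: `r_i = #{j | c j = i}` (Bertrand's
`J = {r₁, …, r_n}`, `b = r₁ + ⋯ + r_n`). [cite: Bertrand1997DualityTori, §3 (b) (p. 213)] -/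
def wordMult {q : ℕ} (c : Fin q → β) (i : β) : ℕ := (univ.filter fun j ↦ c j = i).card

/-- `r_i(c) = #c⁻¹(i)`. [cite: Bertrand1997DualityTori, §3 (b) (p. 213)] -/
theorem wordMult_eq {q : ℕ} (c : Fin q → β) (i : β) : wordMult c i = (univ.filter fun j ↦ c j = i).card := rfl

/-- `r_i(c) = #{j // c j = i}` as a `Fintype.card`. [cite: Bertrand1997DualityTori, §3 (b) (p. 213)] -/
theorem wordMult_eq_card_subtype {q : ℕ} (c : Fin q → β) (i : β) :
    wordMult c i = Fintype.card {j // c j = i} := by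
  rw [wordMult, Fintype.card_subtype]

/-- `Σ_i r_i(c) = q` (`b = r₁ + ⋯ + r_n`). [cite: Bertrand1997DualityTori, §3 (b) (p. 213)] -/
theorem sum_wordMult [Fintype β] {q : ℕ} (c : Fin q → β) : ∑ i, wordMult c i = q := by
  simp only [wordMult]
  rw [← Finset.card_eq_sum_card_fiberwise (f := c) (s := univ) (t := univ) fun _ _ ↦ mem_univ _, card_univ,
    Fintype.card_fin]

/-- A permutation of the letters does not change the multiplicities. [cite: Bertrand1997DualityTori, §3 (b) (p. 213)] -/
theorem wordMult_comp_perm {q : ℕ} (c : Fin q → β) (σ : Equiv.Perm (Fin q)) (i : β) :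
    wordMult (c ∘ σ) i = wordMult c i := by
  rw [wordMult_eq_card_subtype, wordMult_eq_card_subtype]
  exact Fintype.card_congr (σ.subtypeEquiv fun j ↦ Iff.rfl)

end Vocabulary

/-! ## §1 Word monomials: `ω_{f 0} ∧ ⋯ ∧ ω_{f (q-1)} = dx_{f-pairs}`; permutations of the letters -/

section WordMonomials

variable {ι : Type*} {E : Type uE} [NormedAddCommGroup E] [NormedSpace ℂ E] (Φ : (ι → ℝ) ≃L[ℝ] E)
  {g : ℕ} (e₀ : Fin g ⊕ Fin g ≃ ι)

/-- **`ω_{f 0} ∧ ⋯ ∧ ω_{f (q-1)} = dx_{λ_{f 0}} ∧ dx_{μ_{f 0}} ∧ ⋯ ∧ dx_{λ_{f(q-1)}} ∧ dx_{μ_{f(q-1)}}`**: the iterated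
wedge of pair forms along a word `f : Fin q → Fin g` is the interleaved lattice monomial of `f`
(`dx_I ∧ dx_J = dx_{IJ}`). [cite: Lange2023AbelianVarietiesComplex, §1.1.4 Prop. 1.1.20 and §2.5.3 Thm. 2.5.16] -/
theorem wedgeFamily_pairMonomial : ∀ (q : ℕ) (f : Fin q → Fin g),
    wedgeFamily q (fun j ↦ pairMonomial Φ e₀ (f j)) = latMonomial Φ (2 * q) (ilvWord e₀ f)
  | 0, _ => rfl
  | q + 1, f => by
    rw [wedgeFamily_succ, show Fin.init (fun j ↦ pairMonomial Φ e₀ (f j)) = fun j ↦ pairMonomial Φ e₀ (Fin.init f j) from rfl,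
      wedgeFamily_pairMonomial q (Fin.init f), pairMonomial_eq, latMonomial_wedge_latMonomial,
      append_ilvWord e₀ (by ring : 2 * q + 2 * 1 = 2 * (q + 1)), Fin.append_right_eq_snoc, Fin.snoc_init_self]
    rfl

/-- A word with a repeated letter gives the zero monomial (`ω_ν ∧ ω_ν = 0`).
[cite: Lange2023AbelianVarietiesComplex, §2.5.3 Thm. 2.5.16 (proof)] -/
theorem wedgeFamily_pairMonomial_eq_zero_of_not_injective {q : ℕ} {f : Fin q → Fin g} (hf : ¬ Injective f) :
    wedgeFamily q (fun j ↦ pairMonomial Φ e₀ (f j)) = 0 := by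
  rw [wedgeFamily_pairMonomial, latMonomial_eq]
  refine wedgeWord_eq_zero_of_not_injective _ _ _ fun hinj ↦ hf fun i j hij ↦ ?_
  have h := @hinj ((finTwoMulEquivSum q).symm (Sum.inl i)) ((finTwoMulEquivSum q).symm (Sum.inl j))
    (by rw [ilvWord_apply, ilvWord_apply, Equiv.apply_symm_apply, Equiv.apply_symm_apply, Sum.map_inl, Sum.map_inl, hij])
  simpa using h

/-- Permuting the letters of a word does not change its monomial (pairs are even blocks).
[cite: Lange2023AbelianVarietiesComplex, §2.5.3 Lemma 2.5.14 (the sign `ε(I)`)] -/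
theorem wedgeFamily_pairMonomial_comp_perm {q : ℕ} (f : Fin q → Fin g) (σ : Equiv.Perm (Fin q)) :
    wedgeFamily q (fun j ↦ pairMonomial Φ e₀ (f (σ j))) = wedgeFamily q (fun j ↦ pairMonomial Φ e₀ (f j)) :=
  wedgeFamily_comp_perm q (fun j ↦ pairMonomial Φ e₀ (f j)) σ

end WordMonomials

/-! ## §2 Counting: `#{π ∈ 𝔖_q | u ∘ π = c} = ∏_i r_i!` when `u`, `c` have the same multiplicities, else `0` -/

section Counting

variable {β : Type*} [DecidableEq β] {q : ℕ}

/-- Two words are permutations of each other iff they have the same multiplicities; more precisely a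
permutation `π` with `u ∘ π = c` exists as soon as `r_i(u) = r_i(c)` for all `i` (glue fibrewise bijections).
[folklore] -/
private theorem exists_perm_comp_eq_of_wordMult_eq {u c : Fin q → β} (h : ∀ i, wordMult u i = wordMult c i) :
    ∃ π : Equiv.Perm (Fin q), u ∘ ⇑π = c := by
  have e : ∀ i, {j // c j = i} ≃ {j // u j = i} := fun i ↦
    Fintype.equivOfCardEq (by rw [← wordMult_eq_card_subtype, ← wordMult_eq_card_subtype, h])
  exact ⟨Equiv.ofFiberEquiv e, funext fun j ↦ Equiv.ofFiberEquiv_map e j⟩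

/-- Conversely `u ∘ π = c` forces equal multiplicities. [folklore] -/
private theorem wordMult_eq_of_comp_perm_eq {u c : Fin q → β} {π : Equiv.Perm (Fin q)} (h : u ∘ ⇑π = c) (i : β) :
    wordMult u i = wordMult c i := by
  rw [← h, wordMult_comp_perm]

/-- **`#{π ∈ 𝔖_q | u ∘ π = c} = ∏_i r_i(c)!` if `u` and `c` have the same multiplicities, and `= 0` otherwise**:
the solutions form a coset of the stabiliser of `c`, whose order is `∏_i r_i!` (Mathlib's
`DomMulAct.stabilizer_card`) — the count behind "the number of ways to linearly order a multiset with `a_i` objects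
of type `i` is `n!/(a₁!⋯a_k!)`" (Bóna, Thm. 3.5; here `card_filter_wordMult_eq_mul`). This is the coefficient
`r₁!⋯r_n!` of Bertrand's Corollary and, through the classes, the multinomial `c(J) = b!/r₁!⋯r_n!` of his Newton formula.
[cite: Bona2011, Thm. 3.5 (chunk p0050 L7)] [cite: Bertrand1997DualityTori, §3 (b) (p. 214: "`c(J)` is the binomial coefficient `b!/r₁!⋯r_n!`")] -/
theorem card_perm_comp_eq [Fintype β] (u c : Fin q → β) :
    (univ.filter fun π : Equiv.Perm (Fin q) ↦ u ∘ ⇑π = c).card =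
      if ∀ i, wordMult u i = wordMult c i then ∏ i, (wordMult c i).factorial else 0 := by
  split_ifs with h
  · obtain ⟨π₀, hπ₀⟩ := exists_perm_comp_eq_of_wordMult_eq h
    have hu : u = c ∘ ⇑π₀.symm := by
      rw [← hπ₀]; funext j; simp only [comp_apply, Equiv.apply_symm_apply]
    -- the solution set is the coset `π₀ · Stab(c)`
    have key : ∀ π : Equiv.Perm (Fin q), u ∘ ⇑π = c ↔ c ∘ ⇑(π.trans π₀.symm) = c := by
      intro π
      rw [hu, Equiv.coe_trans]
      rfl
    rw [← Fintype.card_subtype]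
    simp_rw [wordMult_eq_card_subtype]
    rw [← DomMulAct.stabilizer_card c]
    exact Fintype.card_congr
      { toFun := fun π ↦ ⟨π.1.trans π₀.symm, (key π.1).1 π.2⟩
        invFun := fun τ ↦ ⟨τ.1.trans π₀, (key _).2 (by
          rw [Equiv.trans_assoc, Equiv.self_trans_symm, Equiv.trans_refl]; exact τ.2)⟩
        left_inv := fun π ↦ Subtype.ext (by
          dsimp only; rw [Equiv.trans_assoc, Equiv.symm_trans_self, Equiv.trans_refl])
        right_inv := fun τ ↦ Subtype.ext (by
          dsimp only; rw [Equiv.trans_assoc, Equiv.self_trans_symm, Equiv.trans_refl]) }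
  · rw [Finset.card_eq_zero, Finset.filter_eq_empty_iff]
    intro π _ hπ
    exact h (wordMult_eq_of_comp_perm_eq hπ)

end Counting

/-! ## §3 The expansion of a block monomial on the interleaved monomials (Thm. 2.5.16 for blocks) -/

section Expansion

variable {g q : ℕ}

/-- **Injective words are the pairs (support, order)**: summing over the injective words `f : Fin q → Fin g` is
summing over the `q`-subsets `T` and the permutations `π` of `Fin q`, through `f = t_T ∘ π` (`t_T` the increasing
enumeration of `T`). [folklore] -/
private theorem sum_filter_injective_eq_sum_sum_perm {M : Type*} [AddCommMonoid M] (G : (Fin q → Fin g) → M) :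
    ∑ f ∈ univ.filter (fun f : Fin q → Fin g ↦ Injective f), G f =
      ∑ T : Set.powersetCard (Fin g) q, ∑ π : Equiv.Perm (Fin q),
        G (⇑(Set.powersetCard.ofFinEmbEquiv.symm T) ∘ ⇑π) := by
  classical
  set φ : Set.powersetCard (Fin g) q × Equiv.Perm (Fin q) → (Fin q → Fin g) :=
    fun x ↦ ⇑(Set.powersetCard.ofFinEmbEquiv.symm x.1) ∘ ⇑x.2 with hφ
  -- the range of `t_T ∘ π` is `T`
  have hrange : ∀ (T : Set.powersetCard (Fin g) q) (π : Equiv.Perm (Fin q)) (i : Fin g),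
      i ∈ Set.range (⇑(Set.powersetCard.ofFinEmbEquiv.symm T) ∘ ⇑π) ↔ i ∈ T := by
    intro T π i
    rw [Set.range_comp, π.surjective.range_eq, Set.image_univ, Set.powersetCard.mem_range_ofFinEmbEquiv_symm_iff_mem]
  have hinj : Injective φ := by
    rintro ⟨T, π⟩ ⟨T', π'⟩ h
    simp only [hφ] at h
    obtain rfl : T = T' := by
      refine Subtype.ext (Finset.ext fun i ↦ ?_)
      rw [Set.powersetCard.mem_coe_iff, Set.powersetCard.mem_coe_iff, ← hrange T π, ← hrange T' π', h]
    simp only [Prod.mk.injEq, true_and]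
    exact Equiv.ext fun j ↦ (Set.powersetCard.ofFinEmbEquiv.symm T).injective (congr_fun h j)
  have himage : univ.image φ = univ.filter fun f : Fin q → Fin g ↦ Injective f := by
    ext f
    simp only [Finset.mem_image, Finset.mem_univ, true_and, Finset.mem_filter]
    constructor
    · rintro ⟨⟨T, π⟩, rfl⟩
      exact (Set.powersetCard.ofFinEmbEquiv.symm T).injective.comp π.injective
    · intro hf
      set T : Set.powersetCard (Fin g) q := Set.powersetCard.ofFinEmb q (Fin g) ⟨f, hf⟩ with hT
      set t := Set.powersetCard.ofFinEmbEquiv.symm T with ht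
      have hr : Set.range f = Set.range ⇑t := by
        ext i
        rw [Set.powersetCard.mem_range_ofFinEmbEquiv_symm_iff_mem, hT,
          Set.powersetCard.mem_ofFinEmb_iff_mem_range]
        rfl
      refine ⟨⟨T, (Equiv.ofInjective f hf).trans ((Equiv.setCongr hr).trans
        (Equiv.ofInjective ⇑t t.injective).symm)⟩, funext fun j ↦ ?_⟩
      simp only [hφ, comp_apply, Equiv.trans_apply]
      rw [Equiv.apply_ofInjective_symm t.injective]
      rfl
  rw [← himage, Finset.sum_image fun x _ y _ h ↦ hinj h, Fintype.sum_prod_type]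

variable {ι : Type*} {E : Type uE} [NormedAddCommGroup E] [NormedSpace ℂ E] (Φ : (ι → ℝ) ≃L[ℝ] E)
  (e₀ : Fin g ⊕ Fin g ≃ ι) (d : Fin g → ℕ) {β : Type*} [Fintype β] [DecidableEq β] (blk : Fin g → β)

omit [Fintype β] in
/-- The letters of `t_T` in block `i` are the elements of `T` in block `i`: `r_i(blk ∘ t_T) = #(T ∩ blk⁻¹ i)`.
[cite: Bertrand1997DualityTori, §3 (b) (p. 213)] -/
theorem wordMult_comp_ofFinEmbEquiv_symm (T : Set.powersetCard (Fin g) q) (i : β) :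
    wordMult (blk ∘ ⇑(Set.powersetCard.ofFinEmbEquiv.symm T)) i =
      ((T : Finset (Fin g)).filter fun ν ↦ blk ν = i).card := by
  set t := Set.powersetCard.ofFinEmbEquiv.symm T with ht
  have hT : (T : Finset (Fin g)) = univ.image ⇑t := by
    ext ν
    rw [Finset.mem_image, Set.powersetCard.mem_coe_iff, ← Set.powersetCard.mem_range_ofFinEmbEquiv_symm_iff_mem]
    simp only [Finset.mem_univ, true_and, Set.mem_range, ht]
  rw [wordMult, hT, Finset.filter_image, Finset.card_image_of_injective _ t.injective]
  rfl

/-- **The expansion of a block monomial** (Theorem 2.5.16 "cohomological form" for blocks): for a word `c` with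
multiplicities `J = (r_i)`,
`θ_{c 0} ∧ ⋯ ∧ θ_{c (q-1)} = (∏_i r_i!) · Σ_{#T = q, #(T ∩ blk⁻¹ i) = r_i ∀ i} (∏_{ν ∈ T} d_ν) · dx_{T-pairs}` —
expand multilinearly into words `f : Fin q → Fin g` (a letter of block `c j` in slot `j`), kill the words with a
repeated letter, and collect the `∏_i r_i!` orderings of each admissible support `T`. The one-block case
(`blk` constant) is the tree's `IsSymplecticEnum.wedgePow_eq_sum` (`E^{∧q} = q! Σ_{#T=q} (∏_T d_ν) dx_{T-pairs}`).
[cite: Bertrand1997DualityTori, §3 (b) (p. 214, Newton's formula and the Corollary)] [cite: Lange2023AbelianVarietiesComplex, §2.5.3 Thm. 2.5.16] -/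
theorem blockPow_eq_sum (c : Fin q → β) :
    blockPow Φ e₀ d blk c =
      ((∏ i, (wordMult c i).factorial : ℕ) : ℂ) • ∑ T : Set.powersetCard (Fin g) q,
        (if ∀ i, ((T : Finset (Fin g)).filter fun ν ↦ blk ν = i).card = wordMult c i
          then ∏ ν ∈ (T : Finset (Fin g)), ((d ν : ℕ) : ℂ) else 0) •
          latMonomial Φ (2 * q) (ilvWord e₀ (Set.powersetCard.ofFinEmbEquiv.symm T)) := by
  classical
  -- Step 1: multilinear expansion into words
  have h1 : blockPow Φ e₀ d blk c = ∑ f : Fin q → Fin g,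
      (∏ j, (if blk (f j) = c j then ((d (f j) : ℕ) : ℂ) else 0)) • wedgeFamily q (fun j ↦ pairMonomial Φ e₀ (f j)) :=
    wedgeFamily_sum_smul q (fun j ν ↦ if blk ν = c j then ((d ν : ℕ) : ℂ) else 0) (fun _ ν ↦ pairMonomial Φ e₀ ν)
  -- Step 2: only injective words survive
  have h2 : (∑ f : Fin q → Fin g,
      (∏ j, (if blk (f j) = c j then ((d (f j) : ℕ) : ℂ) else 0)) • wedgeFamily q (fun j ↦ pairMonomial Φ e₀ (f j))) =
      ∑ f ∈ univ.filter (fun f : Fin q → Fin g ↦ Injective f),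
        (∏ j, (if blk (f j) = c j then ((d (f j) : ℕ) : ℂ) else 0)) • wedgeFamily q (fun j ↦ pairMonomial Φ e₀ (f j)) := by
    rw [Finset.sum_filter_of_ne]
    intro f _ hf
    by_contra hinj
    refine hf ?_
    rw [wedgeFamily_pairMonomial_eq_zero_of_not_injective Φ e₀ hinj]
    ext v
    simp
  rw [h1, h2, sum_filter_injective_eq_sum_sum_perm, Finset.smul_sum]
  refine Finset.sum_congr rfl fun T _ ↦ ?_
  set t := Set.powersetCard.ofFinEmbEquiv.symm T with ht
  -- Step 3: all orderings of `T` give the same monomial `dx_{T-pairs}`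
  have h3 : ∀ π : Equiv.Perm (Fin q), wedgeFamily q (fun j ↦ pairMonomial Φ e₀ ((⇑t ∘ ⇑π) j)) =
      latMonomial Φ (2 * q) (ilvWord e₀ t) := fun π ↦ by
    rw [show (fun j ↦ pairMonomial Φ e₀ ((⇑t ∘ ⇑π) j)) = fun j ↦ pairMonomial Φ e₀ (t (π j)) from rfl,
      wedgeFamily_pairMonomial_comp_perm, wedgeFamily_pairMonomial]
  simp_rw [h3]
  rw [← Finset.sum_smul, smul_smul]
  congr 1
  -- Step 4: the coefficient `Σ_π ∏_j [blk (t (π j)) = c j] d_{t (π j)} = ∏_T d · #{π | blk ∘ t ∘ π = c}`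
  have h4 : ∀ π : Equiv.Perm (Fin q), (∏ j, (if blk ((⇑t ∘ ⇑π) j) = c j then ((d ((⇑t ∘ ⇑π) j) : ℕ) : ℂ) else 0)) =
      if (blk ∘ ⇑t) ∘ ⇑π = c then ∏ ν ∈ (T : Finset (Fin g)), ((d ν : ℕ) : ℂ) else 0 := by
    intro π
    have hT : (T : Finset (Fin g)) = univ.image ⇑t := by
      ext ν
      rw [Finset.mem_image, Set.powersetCard.mem_coe_iff, ← Set.powersetCard.mem_range_ofFinEmbEquiv_symm_iff_mem]
      simp only [Finset.mem_univ, true_and, Set.mem_range, ht]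
    rw [Fintype.prod_ite_zero]
    by_cases hπ : (blk ∘ ⇑t) ∘ ⇑π = c
    · rw [if_pos hπ, if_pos (show ∀ j, blk ((⇑t ∘ ⇑π) j) = c j from fun j ↦ congr_fun hπ j),
        show (fun j ↦ ((d ((⇑t ∘ ⇑π) j) : ℕ) : ℂ)) = fun j ↦ ((d (t (π j)) : ℕ) : ℂ) from rfl,
        Equiv.prod_comp π (fun k ↦ ((d (t k) : ℕ) : ℂ)), hT, Finset.prod_image fun a _ b _ hab ↦ t.injective hab]
    · rw [if_neg hπ, if_neg (show ¬ ∀ j, blk ((⇑t ∘ ⇑π) j) = c j from fun h ↦ hπ (funext h))]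
  simp_rw [h4]
  rw [Finset.sum_ite, Finset.sum_const_zero, add_zero, Finset.sum_const, nsmul_eq_mul, card_perm_comp_eq, ht]
  simp_rw [wordMult_comp_ofFinEmbEquiv_symm blk T]
  split_ifs with hc
  · rfl
  · rw [Nat.cast_zero, zero_mul, mul_zero]

end Expansion

/-! ## §4 The polarisation map on block monomials: `η♭(P⁻¹ θ^{c′}) = (-1)^{p+q} (J′!/J!) (d₁⋯d_g) θ^{c}` -/

section Integral

variable {ι : Type*} {E : Type uE} [NormedAddCommGroup E] [NormedSpace ℂ E] (Φ : (ι → ℝ) ≃L[ℝ] E)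
  {g : ℕ} (e₀ : Fin g ⊕ Fin g ≃ ι) (d : Fin g → ℕ) {β : Type*} [DecidableEq β] (blk : Fin g → β)

/-- The pair forms are integral classes (`dx_ν ∧ dx_{g+ν} ∈ H²(X, ℤ)`). [cite: Lange2023AbelianVarietiesComplex, §1.1.3 Exercise 1.1.6 (7)] -/
theorem pairMonomial_mem_integralForms (ν : Fin g) : pairMonomial Φ e₀ ν ∈ integralForms Φ 2 :=
  latMonomial_mem_integralForms Φ (2 * 1) _

/-- The block forms are integral classes (`θ_i ∈ H²(X, ℤ)`). [cite: Bertrand1997DualityTori, §3 (b) (p. 213)] -/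
theorem blockTwoForm_mem_integralForms (i : β) : blockTwoForm Φ e₀ d blk i ∈ integralForms Φ 2 := by
  refine sum_mem fun ν _ ↦ ?_
  have h := intCast_smul_mem_integralForms Φ (pairMonomial_mem_integralForms Φ e₀ ν) (if blk ν = i then (d ν : ℤ) else 0)
  simp only [Int.cast_ite, Int.cast_natCast, Int.cast_zero] at h
  exact h

/-- The block monomials are integral classes (`θ^c ∈ H^{2q}(X, ℤ)`). [cite: Bertrand1997DualityTori, §3 (b) (p. 214)] -/
theorem blockPow_mem_integralForms [Fintype ι] {q : ℕ} (c : Fin q → β) : blockPow Φ e₀ d blk c ∈ integralForms Φ (2 * q) :=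
  wedgeFamily_mem_integralForms Φ q _ fun j ↦ blockTwoForm_mem_integralForms Φ e₀ d blk (c j)

end Integral

section Flat

variable {ι : Type*} [Fintype ι] [LinearOrder ι] {E : Type uE} [NormedAddCommGroup E] [NormedSpace ℂ E]
  (Φ : (ι → ℝ) ≃L[ℝ] E) {g : ℕ} {e₀ : Fin g ⊕ Fin g ≃ ι} {η : E [⋀^Fin 2]→L[ℝ] ℝ} {d : Fin g → ℕ}
  {G : Matrix ι ι ℤ} {β : Type*} [Fintype β] [DecidableEq β]

omit [Fintype ι] [LinearOrder ι] [NormedAddCommGroup E] [NormedSpace ℂ E] [Fintype β] in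
/-- Inside / outside counts of a block: `#(T ∩ blk⁻¹ i) + #(Tᶜ ∩ blk⁻¹ i) = #blk⁻¹ i`. [folklore] -/
private theorem card_filter_add_card_filter_compl (blk : Fin g → β) (T : Finset (Fin g)) (i : β) :
    (T.filter fun ν ↦ blk ν = i).card + (Tᶜ.filter fun ν ↦ blk ν = i).card =
      (univ.filter fun ν ↦ blk ν = i).card := by
  rw [← Finset.card_union_of_disjoint (Finset.disjoint_filter_filter disjoint_compl_right),
    ← Finset.filter_union, Finset.union_compl]

omit [Fintype ι] [LinearOrder ι] [NormedAddCommGroup E] [NormedSpace ℂ E] [Fintype β] in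
/-- **Complementary multiplicities pass to complementary supports**: if `J + J′ = (#blk⁻¹ i)_i` then
`T` has block counts `J′` iff `Tᶜ` has block counts `J` (Bertrand's `J′ = {r′_i = c_i - r_i}`).
[cite: Bertrand1997DualityTori, §3 (b) (p. 214: "we denote the 'complementary' set of `J` by `J′ = {r′₁ = c₁ - r₁, …, r′_n = c_n - r_n}`")] -/
theorem forall_card_filter_eq_iff_compl (blk : Fin g → β) {q p : ℕ} {c : Fin q → β} {c' : Fin p → β}
    (hcc' : ∀ i, wordMult c i + wordMult c' i = (univ.filter fun ν ↦ blk ν = i).card) (T : Finset (Fin g)) :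
    (∀ i, (T.filter fun ν ↦ blk ν = i).card = wordMult c' i) ↔
      ∀ i, (Tᶜ.filter fun ν ↦ blk ν = i).card = wordMult c i := by
  refine forall_congr' fun i ↦ ?_
  have h1 := card_filter_add_card_filter_compl blk T i
  have h2 := hcc' i
  omega

/-- `(-1)^{2q + 2q(2q-1)/2} = (-1)^q` (the sign of Prop. 6.2.20 in even degree). [folklore] -/
private theorem neg_one_pow_two_mul_add' (q : ℕ) :
    (-1 : ℂ) ^ (2 * q + 2 * q * (2 * q - 1) / 2) = (-1) ^ q := by
  have h1 : 2 * q * (2 * q - 1) / 2 = q * (2 * q - 1) := by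
    rw [mul_assoc, Nat.mul_div_cancel_left _ (by norm_num : 0 < 2)]
  have h2 : Even (2 * q + q * (2 * q - 1) + q) := by
    rcases Nat.eq_zero_or_pos q with rfl | hq
    · simp
    · have h3 : q * (2 * q - 1) + q = q * (2 * q) := by
        rw [← mul_add_one, Nat.sub_add_cancel (by omega : 1 ≤ 2 * q)]
      rw [add_assoc, h3]
      exact ⟨q + q * q, by ring⟩
  rw [h1]
  calc (-1 : ℂ) ^ (2 * q + q * (2 * q - 1))
      = (-1) ^ (2 * q + q * (2 * q - 1)) * ((-1) ^ q * (-1) ^ q) := by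
        rw [← mul_pow, neg_mul_neg, one_mul, one_pow, mul_one]
    _ = (-1) ^ (2 * q + q * (2 * q - 1) + q) * (-1) ^ q := by ring
    _ = (-1) ^ q := by rw [h2.neg_one_pow, one_mul]

/-- `∏_i d_{t_S i} = ∏_{ν ∈ S} d_ν` for the increasing enumeration `t_S` of `S`. [folklore] -/
private theorem prod_ofFinEmbEquiv_symm_eq {q : ℕ} (S : Set.powersetCard (Fin g) q) :
    (∏ i, ((d (Set.powersetCard.ofFinEmbEquiv.symm S i) : ℕ) : ℂ)) = ∏ ν ∈ (S : Finset (Fin g)), (d ν : ℂ) := by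
  have hS : (S : Finset (Fin g)) = Finset.univ.image ⇑(Set.powersetCard.ofFinEmbEquiv.symm S) := by
    ext ν
    rw [Finset.mem_image, Set.powersetCard.mem_coe_iff, ← Set.powersetCard.mem_range_ofFinEmbEquiv_symm_iff_mem]
    simp only [Finset.mem_univ, true_and, Set.mem_range]
  rw [hS, Finset.prod_image fun a _ b _ hab ↦ (Set.powersetCard.ofFinEmbEquiv.symm S).injective hab]

/-- **`φ_L^* F(θ^{c′}) = (-1)^p (J′!/J!) (d₁⋯d_g) · θ^{c}`** (`|c′| = p`, `|c| = q`, `p + q = g`, complementary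
multiplicities `J + J′ = (#blk⁻¹ i)_i`): expand `θ^{c′} = J′! Σ_{T ⊨ J′} (∏_T d) dx_{T-pairs}` (§3), apply
`F(dx_{T-pairs}) = (-1)^p dx̂_{Tᶜ-pairs}` and `φ_L^* dx̂_{Tᶜ-pairs} = (∏_{Tᶜ} d)² dx_{Tᶜ-pairs}` (Beauville's theorem
monomial by monomial, prover p16), and resum over `S = Tᶜ ⊨ J`: `Σ_T (∏_T d)(∏_{Tᶜ} d)² dx_{Tᶜ-pairs} = (d₁⋯d_g) θ^{c}/J!`.
The one-block case is the tree's `IsSymplecticEnum.fourierForm_wedgePow_compContinuousLinearMap_realRep`.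
[cite: Bertrand1997DualityTori, §3 (b) Corollary (p. 214) and its proof (pp. 214–215: the polarisations `λ_z = Σ zᵢ pᵢ^*λᵢ`)] [cite: Lange2023AbelianVarietiesComplex, §6.3.2 Thm. 6.3.5 with §6.2.4 Prop. 6.2.20] -/
theorem IsSymplecticEnum.fourierForm_blockPow_compContinuousLinearMap_realRep (hs : IsSymplecticEnum Φ e₀ η d)
    (hη : IsRiemannForm Φ η) (hG : G.map (Int.cast : ℤ → ℝ) = latticeGram Φ η) {p q : ℕ}
    (hm : q + p = Fintype.card (Fin g)) (e : Fin (2 * p + 2 * q) ≃ ι) (blk : Fin g → β) {c : Fin q → β}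
    {c' : Fin p → β} (hcc' : ∀ i, wordMult c i + wordMult c' i = (univ.filter fun ν ↦ blk ν = i).card) :
    (fourierForm Φ e rfl (blockPow Φ e₀ d blk c')).compContinuousLinearMap (realRep Φ (dualPeriod Φ) G.transpose) =
      ((-1 : ℂ) ^ p * (∏ i, ((wordMult c' i).factorial : ℂ)) * (∏ i, (d i : ℂ)) *
        (∏ i, ((wordMult c i).factorial : ℂ))⁻¹) • blockPow Φ e₀ d blk c := by
  classical
  have hfc : (∏ i, ((wordMult c i).factorial : ℂ)) ≠ 0 :=
    Finset.prod_ne_zero_iff.2 fun i _ ↦ by exact_mod_cast (Nat.factorial_pos _).ne'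
  -- `F` and `φ_L^*` as linear maps
  let F : (E [⋀^Fin (2 * p)]→L[ℝ] ℂ) →ₗ[ℂ] ((E →L⋆[ℂ] ℂ) [⋀^Fin (2 * q)]→L[ℝ] ℂ) :=
    { toFun := fourierForm Φ e rfl
      map_add' := fourierForm_add Φ e rfl
      map_smul' := fourierForm_smul Φ e rfl }
  have hF : ∀ y, fourierForm Φ e rfl y = F y := fun _ ↦ rfl
  let P : ((E →L⋆[ℂ] ℂ) [⋀^Fin (2 * q)]→L[ℝ] ℂ) →ₗ[ℂ] (E [⋀^Fin (2 * q)]→L[ℝ] ℂ) :=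
    { toFun := fun θ ↦ θ.compContinuousLinearMap (realRep Φ (dualPeriod Φ) G.transpose)
      map_add' := fun _ _ ↦ by ext; rfl
      map_smul' := fun _ _ ↦ by ext; rfl }
  have hP : ∀ θ : (E →L⋆[ℂ] ℂ) [⋀^Fin (2 * q)]→L[ℝ] ℂ,
      θ.compContinuousLinearMap (realRep Φ (dualPeriod Φ) G.transpose) = P θ := fun _ ↦ rfl
  -- Step 1: expand, transform and pull back termwise
  have hstep : (fourierForm Φ e rfl (blockPow Φ e₀ d blk c')).compContinuousLinearMap
      (realRep Φ (dualPeriod Φ) G.transpose) =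
      ((∏ i, (wordMult c' i).factorial : ℕ) : ℂ) • ∑ T : Set.powersetCard (Fin g) p,
        ((if ∀ i, ((T : Finset (Fin g)).filter fun ν ↦ blk ν = i).card = wordMult c' i
            then ∏ ν ∈ (T : Finset (Fin g)), ((d ν : ℕ) : ℂ) else 0) * ((-1) ^ p *
          (∏ i, ((d (Set.powersetCard.ofFinEmbEquiv.symm (Set.powersetCard.compl hm T) i) : ℕ) : ℂ)) ^ 2)) •
          latMonomial Φ (2 * q)
            (ilvWord e₀ (Set.powersetCard.ofFinEmbEquiv.symm (Set.powersetCard.compl hm T))) := by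
    rw [blockPow_eq_sum, hF, map_smul, map_sum, hP, map_smul, map_sum]
    congr 1
    refine Finset.sum_congr rfl fun T _ ↦ ?_
    rw [map_smul, map_smul, ← hF, hs.fourierForm_latMonomial_ilvWord Φ hη hm e T, map_smul, ← hP,
      hs.latMonomial_dual_ilvWord_comp_realRep Φ hG, smul_smul, smul_smul, mul_assoc]
  -- Step 2: reindex the expansion of `θ^c` by `T ↦ Tᶜ` and compare termwise
  rw [hstep, blockPow_eq_sum Φ e₀ d blk c, smul_smul, Finset.smul_sum, Finset.smul_sum,
    ← Equiv.sum_comp (Set.powersetCard.compl hm) _]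
  refine Finset.sum_congr rfl fun T _ ↦ ?_
  rw [smul_smul, smul_smul, prod_ofFinEmbEquiv_symm_eq, Set.powersetCard.coe_compl]
  congr 1
  have htot : (∏ ν ∈ (T : Finset (Fin g)), (d ν : ℂ)) * ∏ ν ∈ (T : Finset (Fin g))ᶜ, (d ν : ℂ) =
      ∏ i, (d i : ℂ) := Finset.prod_mul_prod_compl _ _
  have hiff := forall_card_filter_eq_iff_compl blk hcc' (T : Finset (Fin g))
  by_cases hc : ∀ i, (((T : Finset (Fin g))).filter fun ν ↦ blk ν = i).card = wordMult c' i
  · rw [if_pos hc, if_pos (hiff.1 hc)]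
    simp only [Nat.cast_prod]
    have hinv : (∏ i, ((wordMult c i).factorial : ℂ))⁻¹ * (∏ i, ((wordMult c i).factorial : ℂ)) = 1 :=
      inv_mul_cancel₀ hfc
    linear_combination ((∏ i, ((wordMult c' i).factorial : ℂ)) * (-1 : ℂ) ^ p *
        ∏ ν ∈ (T : Finset (Fin g))ᶜ, (d ν : ℂ)) * htot -
      ((∏ i, ((wordMult c' i).factorial : ℂ)) * (-1 : ℂ) ^ p * (∏ ν ∈ (T : Finset (Fin g))ᶜ, (d ν : ℂ)) *
        ∏ i, (d i : ℂ)) * hinv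
  · rw [if_neg hc, if_neg fun h ↦ hc (hiff.2 h)]
    simp

/-- **`η♭(P⁻¹ θ^{c′}) = (-1)^{p+q} (J′!/J!) (d₁⋯d_g) · θ^{c}`** for complementary multiplicities `J + J′ = (#blk⁻¹ i)_i`
(`|c′| = p`, `|c| = q`, `p + q = g`): the polarisation map carries the Poincaré-dual homology class of the block
monomial `θ^{c′}` to `(J′!/J!) (d₁⋯d_g)` times the complementary block monomial `θ^c` — through §2 of
`ComplexTorusPolarizationFlatFourier` (`η♭ ∘ P⁻¹ = ± φ_L^* ∘ F`). The one-block case `J = (q)`, `J′ = (p)` is the tree's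
`IsSymplecticEnum.polFlat_cyclePoincareDualEquiv_symm_wedgePow` (Beauville's Thm. 6.3.5 through `η♭`).
[cite: Bertrand1997DualityTori, §3 (b) Corollary (p. 214)] [cite: Lange2023AbelianVarietiesComplex, §6.3.2 Thm. 6.3.5, §6.2.4 Prop. 6.2.20, §1.4.2 Lemma 1.4.5] -/
theorem IsSymplecticEnum.polFlat_cyclePoincareDualEquiv_symm_blockPow (hs : IsSymplecticEnum Φ e₀ η d)
    (hη : IsRiemannForm Φ η) (hG : G.map (Int.cast : ℤ → ℝ) = latticeGram Φ η) {p q : ℕ}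
    (hm : q + p = Fintype.card (Fin g)) (e : Fin (2 * p + 2 * q) ≃ ι) (blk : Fin g → β) {c : Fin q → β}
    {c' : Fin p → β} (hcc' : ∀ i, wordMult c i + wordMult c' i = (univ.filter fun ν ↦ blk ν = i).card) :
    polFlat Φ η (2 * q) ((cyclePoincareDualEquiv Φ e (k := 2 * q)).symm
        ⟨blockPow Φ e₀ d blk c', blockPow_mem_integralForms Φ e₀ d blk c'⟩) =
      ((-1 : ℂ) ^ (p + q) * (∏ i, ((wordMult c' i).factorial : ℂ)) * (∏ i, (d i : ℂ)) *
        (∏ i, ((wordMult c i).factorial : ℂ))⁻¹) • blockPow Φ e₀ d blk c := by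
  rw [polFlat_cyclePoincareDualEquiv_symm_eq_smul_fourierForm Φ e hG]
  have hx : (((⟨blockPow Φ e₀ d blk c', blockPow_mem_integralForms Φ e₀ d blk c'⟩ :
      (integralForms Φ (2 * p)).toIntSubmodule) : E [⋀^Fin (2 * p)]→L[ℝ] ℂ)) = blockPow Φ e₀ d blk c' := rfl
  rw [hx, hs.fourierForm_blockPow_compContinuousLinearMap_realRep Φ hη hG hm e blk hcc', smul_smul,
    neg_one_pow_two_mul_add', pow_add]
  congr 1
  ring

/-- Hypothesis form: **`η♭(σ) = (-1)^{p+q} (J′!/J!) (d₁⋯d_g) · θ^{c}` for every cycle `σ ∈ H_{2q}(X, ℤ)` Poincaré dual to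
`θ^{c′}`**. [cite: Bertrand1997DualityTori, §3 (b) Corollary (p. 214)] [cite: Lange2023AbelianVarietiesComplex, §6.3.2 Thm. 6.3.5] -/
theorem IsSymplecticEnum.polFlat_eq_of_cyclePoincareDual_eq_blockPow (hs : IsSymplecticEnum Φ e₀ η d)
    (hη : IsRiemannForm Φ η) (hG : G.map (Int.cast : ℤ → ℝ) = latticeGram Φ η) {p q : ℕ}
    (hm : q + p = Fintype.card (Fin g)) (e : Fin (2 * p + 2 * q) ≃ ι) (blk : Fin g → β) {c : Fin q → β}
    {c' : Fin p → β} (hcc' : ∀ i, wordMult c i + wordMult c' i = (univ.filter fun ν ↦ blk ν = i).card)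
    {σ : ⋀[ℤ]^(2 * q) (ι → ℤ)} (hσ : cyclePoincareDual Φ e σ = blockPow Φ e₀ d blk c') :
    polFlat Φ η (2 * q) σ =
      ((-1 : ℂ) ^ (p + q) * (∏ i, ((wordMult c' i).factorial : ℂ)) * (∏ i, (d i : ℂ)) *
        (∏ i, ((wordMult c i).factorial : ℂ))⁻¹) • blockPow Φ e₀ d blk c := by
  have hσ' : σ = (cyclePoincareDualEquiv Φ e (k := 2 * q)).symm
      ⟨blockPow Φ e₀ d blk c', blockPow_mem_integralForms Φ e₀ d blk c'⟩ :=
    cyclePoincareDual_injective Φ e (hσ.trans (cyclePoincareDual_symm_apply Φ e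
      (⟨blockPow Φ e₀ d blk c', blockPow_mem_integralForms Φ e₀ d blk c'⟩ :
        (integralForms Φ (2 * p)).toIntSubmodule)).symm)
  rw [hσ', hs.polFlat_cyclePoincareDualEquiv_symm_blockPow Φ hη hG hm e blk hcc']

end Flat

/-! ## §5 The Corollary on forms: `J! · ∫_X ch^{J′} ∧ η♭(σ) = (d₁⋯d_g) · J′! · ∫_σ ch^{J}` for all `σ ∈ H_{2q}(X, ℤ)` -/

section Corollary

variable {ι : Type*} [Fintype ι] [LinearOrder ι] {E : Type uE} [NormedAddCommGroup E] [NormedSpace ℂ E]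
  (Φ : (ι → ℝ) ≃L[ℝ] E) {g : ℕ} {e₀ : Fin g ⊕ Fin g ≃ ι} {η : E [⋀^Fin 2]→L[ℝ] ℝ} {d : Fin g → ℕ}
  {G : Matrix ι ι ℤ} {β : Type*} [Fintype β] [DecidableEq β] {p q : ℕ}

omit [LinearOrder ι] [Fintype β] [DecidableEq β] in
/-- **`∫_X x ∧ η♭(σ) = ∫_σ η♭(P⁻¹ x)`** for an integral class `x ∈ H^{2p}(X, ℤ)` and `σ ∈ H_{2q}(X, ℤ)`: `∫_X x ∧ φ = ∫_{P⁻¹x} φ`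
(the defining property of `P`) and the symmetry `∫_τ η♭(σ) = ∫_σ η♭(τ)` in even degree (Prop. 1.4.6 (c)).
[cite: Lange2023AbelianVarietiesComplex, §2.5.3 Lemma 2.5.14 (proof) and §1.4.2 Prop. 1.4.6 (c)] -/
theorem torusIntegral_wedge_polFlat_eq_cycleIntegral_of_mem [DecidableEq ι] {x : E [⋀^Fin (2 * p)]→L[ℝ] ℂ}
    (hx : x ∈ integralForms Φ (2 * p)) (e : Fin (2 * p + 2 * q) ≃ ι) (σ : ⋀[ℤ]^(2 * q) (ι → ℤ)) :
    torusIntegral Φ e (x.wedge (polFlat Φ η (2 * q) σ)) =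
      cycleIntegral Φ (2 * q) σ (polFlat Φ η (2 * q) ((cyclePoincareDualEquiv Φ e (k := 2 * q)).symm
        ⟨x, hx⟩)) := by
  rw [← cycleIntegral_cyclePoincareDualEquiv_symm Φ e (⟨x, hx⟩ : (integralForms Φ (2 * p)).toIntSubmodule)
    (polFlat Φ η (2 * q) σ), cycleIntegral_polFlat_comm, pow_mul, neg_one_sq, one_pow, one_mul]

/-- **`∫_X θ^{c′} ∧ η♭(σ) = (-1)^{p+q} (J′!/J!) (d₁⋯d_g) · ∫_σ θ^{c}` for every `σ ∈ H_{2q}(X, ℤ)`** (complementary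
multiplicities, `p + q = g`). [cite: Bertrand1997DualityTori, §3 (b) Corollary (p. 214)] [cite: Lange2023AbelianVarietiesComplex, §6.3.2 Thm. 6.3.5 and §2.5.3 Lemma 2.5.14] -/
theorem IsSymplecticEnum.torusIntegral_blockPow_wedge_polFlat (hs : IsSymplecticEnum Φ e₀ η d)
    (hη : IsRiemannForm Φ η) (hG : G.map (Int.cast : ℤ → ℝ) = latticeGram Φ η)
    (hm : q + p = Fintype.card (Fin g)) (e : Fin (2 * p + 2 * q) ≃ ι) (blk : Fin g → β) {c : Fin q → β}
    {c' : Fin p → β} (hcc' : ∀ i, wordMult c i + wordMult c' i = (univ.filter fun ν ↦ blk ν = i).card)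
    (σ : ⋀[ℤ]^(2 * q) (ι → ℤ)) :
    torusIntegral Φ e ((blockPow Φ e₀ d blk c').wedge (polFlat Φ η (2 * q) σ)) =
      ((-1 : ℂ) ^ (p + q) * (∏ i, ((wordMult c' i).factorial : ℂ)) * (∏ i, (d i : ℂ)) *
        (∏ i, ((wordMult c i).factorial : ℂ))⁻¹) * cycleIntegral Φ (2 * q) σ (blockPow Φ e₀ d blk c) := by
  rw [torusIntegral_wedge_polFlat_eq_cycleIntegral_of_mem Φ (blockPow_mem_integralForms Φ e₀ d blk c') e σ,
    hs.polFlat_cyclePoincareDualEquiv_symm_blockPow Φ hη hG hm e blk hcc', map_smul, smul_eq_mul]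

omit [Fintype ι] [LinearOrder ι] [Fintype β] in
/-- **The Chern monomial `ch^{c} = c₁(p_{c 0}^*L) ∧ ⋯ ∧ c₁(p_{c(q-1)}^*L) = (-1)^q θ^{c}`** (`c₁(p_i^*L_i) = -θ_i`, the tree's
normalisation `c₁(L) = -E`). [cite: Lange2023AbelianVarietiesComplex, §1.7.2 Lemma 1.7.4] -/
theorem wedgeFamily_neg_blockTwoForm (blk : Fin g → β) (c : Fin q → β) :
    wedgeFamily q (fun j ↦ -blockTwoForm Φ e₀ d blk (c j)) = ((-1 : ℂ) ^ q) • blockPow Φ e₀ d blk c := by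
  have h := (wedgeFamilyMultilinear (E := E) q).map_smul_univ (fun _ ↦ (-1 : ℂ))
    (fun j ↦ blockTwoForm Φ e₀ d blk (c j))
  rw [wedgeFamilyMultilinear_apply, wedgeFamilyMultilinear_apply, Finset.prod_const, Finset.card_univ,
    Fintype.card_fin] at h
  rw [blockPow_eq, ← h]
  congr 1
  funext j
  rw [neg_one_smul]

/-- **Bertrand's Corollary on forms, all types: `J! · ∫_X ch^{J′} ∧ η♭(σ) = (d₁⋯d_g) · J′! · ∫_σ ch^{J}` for every
`σ ∈ H_{2q}(X, ℤ)`** (`J! = ∏_i r_i!`, `ch^{J} = ∧_j c₁(p_{c j}^*L_{c j})`, complementary multiplicities `J + J′ = (dim C_i)_i`,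
`p + q = g`). For `σ = [B]` the fundamental class of an abelian subvariety of dimension `b = q` (so that
`η♭([B]) = cl(B^⊥)`, gen 11's duality theorem `IsPrincipalPolarization.torusIntegral_wedge_polFlat_eq_cycleIntegral`) the
left integral is `deg_{J′}(B^⊥)` and the right one `deg_J(B)`: `deg_J(B)/J! = deg_{J′}(B^⊥)/J′!` up to `χ(L) = d₁⋯d_g`.
[cite: Bertrand1997DualityTori, §3 (b) Corollary (p. 214: "`deg_J(B)/r₁!…r_n! = deg_{J′}(B^⊥)/r′₁!…r′_n!`")] [cite: Lange2023AbelianVarietiesComplex, §6.3.2 Thm. 6.3.5] -/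
theorem IsSymplecticEnum.prod_factorial_mul_torusIntegral_chern_wedge_polFlat (hs : IsSymplecticEnum Φ e₀ η d)
    (hη : IsRiemannForm Φ η) (hG : G.map (Int.cast : ℤ → ℝ) = latticeGram Φ η)
    (hm : q + p = Fintype.card (Fin g)) (e : Fin (2 * p + 2 * q) ≃ ι) (blk : Fin g → β) {c : Fin q → β}
    {c' : Fin p → β} (hcc' : ∀ i, wordMult c i + wordMult c' i = (univ.filter fun ν ↦ blk ν = i).card)
    (σ : ⋀[ℤ]^(2 * q) (ι → ℤ)) :
    (∏ i, ((wordMult c i).factorial : ℂ)) *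
        torusIntegral Φ e ((wedgeFamily p fun j ↦ -blockTwoForm Φ e₀ d blk (c' j)).wedge (polFlat Φ η (2 * q) σ)) =
      (∏ i, (d i : ℂ)) * (∏ i, ((wordMult c' i).factorial : ℂ)) *
        cycleIntegral Φ (2 * q) σ (wedgeFamily q fun j ↦ -blockTwoForm Φ e₀ d blk (c j)) := by
  have hfc : (∏ i, ((wordMult c i).factorial : ℂ)) ≠ 0 :=
    Finset.prod_ne_zero_iff.2 fun i _ ↦ by exact_mod_cast (Nat.factorial_pos _).ne'
  rw [wedgeFamily_neg_blockTwoForm, wedgeFamily_neg_blockTwoForm, wedge_smul_left_complex, torusIntegral_smul, map_smul,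
    smul_eq_mul, hs.torusIntegral_blockPow_wedge_polFlat Φ hη hG hm e blk hcc' σ, pow_add]
  have h1 : ((-1 : ℂ) ^ p) * (-1) ^ p = 1 := by rw [← mul_pow, neg_mul_neg, one_mul, one_pow]
  have hinv : (∏ i, ((wordMult c i).factorial : ℂ)) * (∏ i, ((wordMult c i).factorial : ℂ))⁻¹ = 1 :=
    mul_inv_cancel₀ hfc
  linear_combination ((-1 : ℂ) ^ q * (∏ i, ((wordMult c' i).factorial : ℂ)) * (∏ i, (d i : ℂ)) *
      cycleIntegral Φ (2 * q) σ (blockPow Φ e₀ d blk c) *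
      ((∏ i, ((wordMult c i).factorial : ℂ)) * (∏ i, ((wordMult c i).factorial : ℂ))⁻¹)) * h1 +
    ((-1 : ℂ) ^ q * (∏ i, ((wordMult c' i).factorial : ℂ)) * (∏ i, (d i : ℂ)) *
      cycleIntegral Φ (2 * q) σ (blockPow Φ e₀ d blk c)) * hinv

/-- **Bertrand's Corollary on forms, principal case: `J! · ∫_X θ^{J′} ∧ η♭(σ) = J′! · ∫_σ θ^{J}` for every
`σ ∈ H_{2q}(X, ℤ)`** — for a PRINCIPAL polarisation presented by blocks of a symplectic basis (`(A, Θ) = ∏ᵢ (Cᵢ, Θᵢ)`,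
`θ_i = c₁(p_i^*Θ_i)`), complementary multiplicities `J + J′ = (dim Cᵢ)ᵢ`: with `σ = [B]` (`dim B = b = |J|`,
`η♭([B]) = cl(B^⊥)`) this is "`deg_J(B)/r₁!…r_n! = deg_{J′}(B^⊥)/r′₁!…r′_n!`" verbatim, here for every integral
cycle `σ`, algebraic or not. [cite: Bertrand1997DualityTori, §3 (b) Corollary (p. 214)] -/
theorem IsSymplecticEnum.prod_factorial_mul_torusIntegral_chern_wedge_polFlat_of_principal
    (hs : IsSymplecticEnum Φ e₀ η d) (hpp : IsPrincipalPolarization Φ η)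
    (hG : G.map (Int.cast : ℤ → ℝ) = latticeGram Φ η) (hm : q + p = Fintype.card (Fin g))
    (e : Fin (2 * p + 2 * q) ≃ ι) (blk : Fin g → β) {c : Fin q → β} {c' : Fin p → β}
    (hcc' : ∀ i, wordMult c i + wordMult c' i = (univ.filter fun ν ↦ blk ν = i).card) (σ : ⋀[ℤ]^(2 * q) (ι → ℤ)) :
    (∏ i, ((wordMult c i).factorial : ℂ)) *
        torusIntegral Φ e ((wedgeFamily p fun j ↦ -blockTwoForm Φ e₀ d blk (c' j)).wedge (polFlat Φ η (2 * q) σ)) =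
      (∏ i, ((wordMult c' i).factorial : ℂ)) *
        cycleIntegral Φ (2 * q) σ (wedgeFamily q fun j ↦ -blockTwoForm Φ e₀ d blk (c j)) := by
  rw [hs.prod_factorial_mul_torusIntegral_chern_wedge_polFlat Φ hpp.isRiemannForm hG hm e blk hcc' σ,
    Finset.prod_eq_one fun i _ ↦ by rw [hpp.type_eq_one hs.isPolarizationType i, Nat.cast_one], one_mul]

end Corollary

/-! ## §6 `Σ_i θ_i = E` and Newton's formula `E^{∧b} = Σ_{words c} θ^{c}` -/

section Newton

variable {ι : Type*} [Fintype ι] [DecidableEq ι] {E : Type uE} [NormedAddCommGroup E] [NormedSpace ℂ E]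
  (Φ : (ι → ℝ) ≃L[ℝ] E) {g : ℕ} (e₀ : Fin g ⊕ Fin g ≃ ι) {η : E [⋀^Fin 2]→L[ℝ] ℝ} (d : Fin g → ℕ)
  {β : Type*} [Fintype β] [DecidableEq β] (blk : Fin g → β)

omit [Fintype ι] [DecidableEq ι] in
/-- **`Σ_i θ_i = Σ_ν d_ν dx_ν ∧ dx_{g+ν}`**: every pair lies in exactly one block. [cite: Bertrand1997DualityTori, §3 (b) (p. 213: "`λ = p₁^*λ₁ + ⋯ + p_n^*λ_n`")] -/
theorem sum_blockTwoForm : ∑ i, blockTwoForm Φ e₀ d blk i = ∑ ν, ((d ν : ℕ) : ℂ) • pairMonomial Φ e₀ ν := by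
  simp only [blockTwoForm]
  rw [Finset.sum_comm]
  refine Finset.sum_congr rfl fun ν _ ↦ ?_
  rw [← Finset.sum_smul, Finset.sum_ite_eq]
  simp

omit [Fintype ι] [DecidableEq ι] in
/-- `θ^{∧1} = θ`. [folklore] -/
private theorem wedgePow_one_eq_self'' (θ : E [⋀^Fin 2]→L[ℝ] ℂ) : wedgePow θ 1 = θ := by
  rw [wedgePow_one, Literature.Analysis.Complex.oneForm₀, ContinuousAlternatingMap.constOfIsEmpty_one_wedge]
  ext v
  rfl

/-- **`E = Σ_ν d_ν dx_ν ∧ dx_{g+ν}` on a symplectic basis of type `d`** (Lemma 1.7.4: `c₁(L) = -Σ d_ν dx_ν ∧ dx_{g+ν}`; the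
case `q = 1` of the tree's `IsSymplecticEnum.wedgePow_eq_sum`). [cite: Lange2023AbelianVarietiesComplex, §1.7.2 Lemma 1.7.4] -/
theorem IsSymplecticEnum.ofRealForm_eq_sum_pairMonomial (hs : IsSymplecticEnum Φ e₀ η d) :
    ofRealForm η = ∑ ν, ((d ν : ℕ) : ℂ) • pairMonomial Φ e₀ ν := by
  classical
  have h := hs.wedgePow_eq_sum Φ 1
  rw [wedgePow_one_eq_self'', Nat.factorial_one, Nat.cast_one, one_smul] at h
  rw [h]
  -- reindex the `1`-subsets by their element
  let s : Fin g → Set.powersetCard (Fin g) 1 := fun ν ↦ Set.powersetCard.ofCard (Finset.card_singleton ν)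
  have hs1 : ∀ T : Set.powersetCard (Fin g) 1, ∃ ν, (T : Finset (Fin g)) = {ν} := fun T ↦
    Finset.card_eq_one.1 (Set.powersetCard.card_eq T)
  have hbij : Function.Bijective s := by
    refine ⟨fun ν ν' h ↦ ?_, fun T ↦ ?_⟩
    · have h' : ({ν} : Finset (Fin g)) = {ν'} := congrArg Subtype.val h
      exact Finset.singleton_injective h'
    · obtain ⟨ν, hν⟩ := hs1 T
      exact ⟨ν, Subtype.ext hν.symm⟩
  rw [← (Equiv.ofBijective s hbij).sum_comp]
  refine Finset.sum_congr rfl fun ν _ ↦ ?_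
  have hval : ((Equiv.ofBijective s hbij ν : Set.powersetCard (Fin g) 1) : Finset (Fin g)) = {ν} := rfl
  have ht : ⇑(Set.powersetCard.ofFinEmbEquiv.symm (Equiv.ofBijective s hbij ν)) = fun _ : Fin 1 ↦ ν := by
    funext j
    have hj : Set.powersetCard.ofFinEmbEquiv.symm (Equiv.ofBijective s hbij ν) j ∈
        ((Equiv.ofBijective s hbij ν : Set.powersetCard (Fin g) 1) : Finset (Fin g)) :=
      Set.powersetCard.mem_coe_iff.2
        ((Set.powersetCard.mem_range_ofFinEmbEquiv_symm_iff_mem _ _).1 ⟨j, rfl⟩)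
    rw [hval, Finset.mem_singleton] at hj
    exact hj
  rw [hval, Finset.prod_singleton, ht, pairMonomial_eq]

/-- **`Σ_i θ_i = E`**: the block forms decompose the polarisation form (`λ = p₁^*λ₁ + ⋯ + p_n^*λ_n`).
[cite: Bertrand1997DualityTori, §3 (b) (p. 213: "`λ = p₁^*λ₁ + ⋯ + p_n^*λ_n`, where `p_i` is the projection from `A` to `C_i`")] -/
theorem IsSymplecticEnum.sum_blockTwoForm_eq_ofRealForm (hs : IsSymplecticEnum Φ e₀ η d) :
    ∑ i, blockTwoForm Φ e₀ d blk i = ofRealForm η := by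
  rw [sum_blockTwoForm, hs.ofRealForm_eq_sum_pairMonomial Φ e₀ d]

omit [Fintype ι] [DecidableEq ι] in
/-- **Newton's formula in word form: `(Σ_i θ_i)^{∧b} = Σ_{c : Fin b → β} θ^{c}`** (multilinear expansion; the words
of a multiplicity class `J` all give the same monomial `θ^J` (`blockPow_comp_perm`) and there are
`c(J) = b!/r₁!⋯r_n!` of them (`card_filter_wordMult_eq_mul`), whence Bertrand's
`deg_λ(W) = Σ_J c(J) deg_J(W)`). [cite: Bertrand1997DualityTori, §3 (b) (p. 214: "Newton's formula: `deg_λ(W) = Σ_J c(J) deg_J(W)` … `c(J)` is the binomial coefficient `b!/r₁!…r_n!`")] -/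
theorem wedgePow_sum_blockTwoForm (b : ℕ) :
    wedgePow (∑ i, blockTwoForm Φ e₀ d blk i) b = ∑ c : Fin b → β, blockPow Φ e₀ d blk c := by
  have h := wedgeFamily_sum_smul b (fun _ _ ↦ (1 : ℂ)) (fun _ i ↦ blockTwoForm Φ e₀ d blk i)
  simp only [one_smul, Finset.prod_const_one] at h
  exact h

/-- **Newton's formula for the polarisation: `E^{∧b} = Σ_{c : Fin b → β} θ^{c}`**, hence
`∫_W c₁(L)^{∧b} = Σ_c ∫_W ch^{c}`, i.e. `deg_λ(W) = Σ_J c(J) deg_J(W)`. [cite: Bertrand1997DualityTori, §3 (b) (p. 214, Newton's formula)] -/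
theorem IsSymplecticEnum.wedgePow_eq_sum_blockPow (hs : IsSymplecticEnum Φ e₀ η d) (b : ℕ) :
    wedgePow (ofRealForm η) b = ∑ c : Fin b → β, blockPow Φ e₀ d blk c := by
  rw [← hs.sum_blockTwoForm_eq_ofRealForm Φ e₀ d blk, wedgePow_sum_blockTwoForm]

omit [Fintype ι] [DecidableEq ι] [NormedAddCommGroup E] [NormedSpace ℂ E] in
/-- **The multinomial count `c(J) = b!/r₁!⋯r_n!`**: the words with the multiplicities of a given word `c` number
`#{c′ | J(c′) = J(c)} · ∏_i r_i! = b!` (orbit–stabiliser for `𝔖_b` acting on words: the class of `c` is its orbit,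
`∏ r_i!` its stabiliser) — Bóna's Thm. 3.5 "the number of ways to linearly order these objects is `n!/(a₁!⋯a_k!)`"
for words read as linear orderings of the multiset of letters. [cite: Bona2011, Thm. 3.5 (chunk p0050 L7)] [cite: Bertrand1997DualityTori, §3 (b) (p. 214: "`c(J)` is the binomial coefficient `b!/r₁!…r_n!`")] -/
theorem card_filter_wordMult_eq_mul {b : ℕ} (c : Fin b → β) :
    (univ.filter fun c' : Fin b → β ↦ ∀ i, wordMult c' i = wordMult c i).card * ∏ i, (wordMult c i).factorial =
      b.factorial := by
  classical
  -- count the pairs `(c′, π)` with `c ∘ π = c′` in two ways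
  have hcount : ∀ c' : Fin b → β, (univ.filter fun π : Equiv.Perm (Fin b) ↦ c ∘ ⇑π = c').card =
      if ∀ i, wordMult c' i = wordMult c i then ∏ i, (wordMult c i).factorial else 0 := by
    intro c'
    rw [card_perm_comp_eq]
    by_cases h : ∀ i, wordMult c i = wordMult c' i
    · rw [if_pos h, if_pos fun i ↦ (h i).symm]
      exact Finset.prod_congr rfl fun i _ ↦ by rw [h i]
    · rw [if_neg h, if_neg fun h' ↦ h fun i ↦ (h' i).symm]
  have htot : ∑ c' : Fin b → β, (univ.filter fun π : Equiv.Perm (Fin b) ↦ c ∘ ⇑π = c').card =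
      (univ : Finset (Equiv.Perm (Fin b))).card := by
    rw [← Finset.card_biUnion]
    · congr 1
      ext π
      simp only [Finset.mem_biUnion, Finset.mem_univ, Finset.mem_filter, true_and, exists_eq']
    · intro c₁ _ c₂ _ hne
      exact Finset.disjoint_filter.2 fun π _ h₁ h₂ ↦ hne (h₁.symm.trans h₂)
  rw [Finset.card_univ, Fintype.card_perm, Fintype.card_fin] at htot
  simp_rw [hcount] at htot
  rw [Finset.sum_ite, Finset.sum_const_zero, add_zero, Finset.sum_const, smul_eq_mul] at htot
  exact htot

end Newton

/-! ## §7 The motivating instance: a product `X₁ × X₂` presented by the concatenated symplectic basis, blocks = factors -/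

section ProductEnum

variable {ι₁ ι₂ : Type*} {g₁ g₂ : ℕ} (e₁ : Fin g₁ ⊕ Fin g₁ ≃ ι₁) (e₂ : Fin g₂ ⊕ Fin g₂ ≃ ι₂)

/-- **The concatenated enumeration of the lattice basis of `X₁ × X₂`**: the pairs `(λ_ν, μ_ν)`, `ν < g₁`, are those of
`X₁` and the pairs `ν = g₁ + ν'` those of `X₂` (a product symplectic basis `λ¹₁, …, λ¹_{g₁}, λ²₁, …, λ²_{g₂}; μ¹₁, …`).
[cite: Bertrand1997DualityTori, §3 (b) (p. 213: "`A` is the product of `n` polarized abelian varieties")] [cite: Lange2023AbelianVarietiesComplex, Cor. 2.4.24] -/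
def prodEnum : Fin (g₁ + g₂) ⊕ Fin (g₁ + g₂) ≃ ι₁ ⊕ ι₂ :=
  (Equiv.sumCongr finSumFinEquiv.symm finSumFinEquiv.symm).trans
    ((Equiv.sumSumSumComm (Fin g₁) (Fin g₂) (Fin g₁) (Fin g₂)).trans (e₁.sumCongr e₂))

/-- `λ_{castAdd a} = λ¹_a`. [cite: Lange2023AbelianVarietiesComplex, Cor. 2.4.24] -/
@[simp] theorem prodEnum_inl_castAdd (a : Fin g₁) :
    prodEnum e₁ e₂ (Sum.inl (Fin.castAdd g₂ a)) = Sum.inl (e₁ (Sum.inl a)) := by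
  simp [prodEnum]

/-- `λ_{g₁ + b} = λ²_b`. [cite: Lange2023AbelianVarietiesComplex, Cor. 2.4.24] -/
@[simp] theorem prodEnum_inl_natAdd (b : Fin g₂) :
    prodEnum e₁ e₂ (Sum.inl (Fin.natAdd g₁ b)) = Sum.inr (e₂ (Sum.inl b)) := by
  simp [prodEnum]

/-- `μ_{castAdd a} = μ¹_a`. [cite: Lange2023AbelianVarietiesComplex, Cor. 2.4.24] -/
@[simp] theorem prodEnum_inr_castAdd (a : Fin g₁) :
    prodEnum e₁ e₂ (Sum.inr (Fin.castAdd g₂ a)) = Sum.inl (e₁ (Sum.inr a)) := by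
  simp [prodEnum]

/-- `μ_{g₁ + b} = μ²_b`. [cite: Lange2023AbelianVarietiesComplex, Cor. 2.4.24] -/
@[simp] theorem prodEnum_inr_natAdd (b : Fin g₂) :
    prodEnum e₁ e₂ (Sum.inr (Fin.natAdd g₁ b)) = Sum.inr (e₂ (Sum.inr b)) := by
  simp [prodEnum]

/-- **The factor map `blk : Fin (g₁ + g₂) → Bool`**: the pair `ν` comes from `X₁` (`blk ν = false`) iff `ν < g₁`, from
`X₂` (`blk ν = true`) otherwise. [cite: Bertrand1997DualityTori, §3 (b) (p. 213)] -/
def prodBlock (g₁ g₂ : ℕ) : Fin (g₁ + g₂) → Bool := fun ν ↦ Fin.addCases (fun _ ↦ false) (fun _ ↦ true) ν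

/-- `blk (castAdd a) = false`. [cite: Bertrand1997DualityTori, §3 (b) (p. 213)] -/
@[simp] theorem prodBlock_castAdd (a : Fin g₁) : prodBlock g₁ g₂ (Fin.castAdd g₂ a) = false := by
  simp [prodBlock]

/-- `blk (g₁ + b) = true`. [cite: Bertrand1997DualityTori, §3 (b) (p. 213)] -/
@[simp] theorem prodBlock_natAdd (b : Fin g₂) : prodBlock g₁ g₂ (Fin.natAdd g₁ b) = true := by
  simp [prodBlock]

/-- **The dimension of the first factor is the size of its block: `#blk⁻¹ false = g₁`** (Bertrand's `c₁ = dim C₁`).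
[cite: Bertrand1997DualityTori, §3 (b) (p. 213: "Denote by `c_i` the dimension of `C_i`")] -/
theorem card_filter_prodBlock_false : (univ.filter fun ν ↦ prodBlock g₁ g₂ ν = false).card = g₁ := by
  have h : (univ.filter fun ν ↦ prodBlock g₁ g₂ ν = false) = univ.image (Fin.castAdd g₂) := by
    ext ν
    simp only [Finset.mem_filter, Finset.mem_univ, true_and, Finset.mem_image]
    refine Fin.addCases (fun a ↦ ?_) (fun b ↦ ?_) ν
    · simp only [prodBlock_castAdd, true_iff]
      exact ⟨a, rfl⟩
    · simp only [prodBlock_natAdd, Bool.true_eq_false, false_iff, not_exists]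
      intro a h
      have h' := congrArg Fin.val h
      simp only [Fin.val_castAdd, Fin.val_natAdd] at h'
      omega
  rw [h, Finset.card_image_of_injective _ (Fin.castAdd_injective _ _), Finset.card_univ, Fintype.card_fin]

/-- **`#blk⁻¹ true = g₂`** (`c₂ = dim C₂`). [cite: Bertrand1997DualityTori, §3 (b) (p. 213)] -/
theorem card_filter_prodBlock_true : (univ.filter fun ν ↦ prodBlock g₁ g₂ ν = true).card = g₂ := by
  have h : (univ.filter fun ν ↦ prodBlock g₁ g₂ ν = true) = univ.image (Fin.natAdd g₁) := by
    ext ν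
    simp only [Finset.mem_filter, Finset.mem_univ, true_and, Finset.mem_image]
    refine Fin.addCases (fun a ↦ ?_) (fun b ↦ ?_) ν
    · simp only [prodBlock_castAdd, Bool.false_eq_true, false_iff, not_exists]
      intro b h
      have h' := congrArg Fin.val h
      simp only [Fin.val_castAdd, Fin.val_natAdd] at h'
      omega
    · simp only [prodBlock_natAdd, true_iff]
      exact ⟨b, rfl⟩
  rw [h, Finset.card_image_of_injective _ (Fin.natAdd_injective _ _), Finset.card_univ, Fintype.card_fin]

/-- `(1, …, 1) ⧺ (1, …, 1) = (1, …, 1)` (the principal type of the product). [folklore] -/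
private theorem append_one_one : (Fin.append (fun _ : Fin g₁ ↦ (1 : ℕ)) fun _ : Fin g₂ ↦ 1) = fun _ ↦ 1 := by
  funext i
  refine Fin.addCases (fun a ↦ ?_) (fun b ↦ ?_) i
  · rw [Fin.append_left]
  · rw [Fin.append_right]

end ProductEnum

section ProductForms

variable {V : Type*} [NormedAddCommGroup V] [NormedSpace ℂ V]

/-- `ω(0, y) = 0`. [folklore] -/
private theorem twoForm_zero_left' (ω : V [⋀^Fin 2]→L[ℝ] ℝ) (y : V) : ω ![0, y] = 0 := by
  rw [← zero_smul ℝ (0 : V), twoForm_smul_left, zero_mul]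

/-- `ω(x, 0) = 0`. [folklore] -/
private theorem twoForm_zero_right' (ω : V [⋀^Fin 2]→L[ℝ] ℝ) (x : V) : ω ![x, 0] = 0 := by
  rw [← zero_smul ℝ (0 : V), twoForm_smul_right, zero_mul]

omit [NormedSpace ℂ V] in
/-- Renaming the alphabet of a wedge word: `(θ ∘ φ)_w = θ_{φ ∘ w}`. [folklore] -/
private theorem wedgeWord_comp_alphabet [NormedSpace ℝ V] {σ σ' : Type*} (θ : σ → (V →L[ℝ] ℂ)) (φ : σ' → σ)
    (c : V [⋀^Fin 0]→L[ℝ] ℂ) :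
    ∀ (k : ℕ) (w : Fin k → σ'), wedgeWord (θ ∘ φ) c k w = wedgeWord θ c k (φ ∘ w)
  | 0, _ => rfl
  | k + 1, w => by
    rw [wedgeWord_succ, wedgeWord_succ, wedgeWord_comp_alphabet θ φ c k (Fin.tail w)]
    rfl

end ProductForms

section ProductTorus

variable {ι₁ ι₂ : Type*} [Fintype ι₁] [Fintype ι₂] [DecidableEq ι₁] [DecidableEq ι₂] {E₁ E₂ : Type*}
  [NormedAddCommGroup E₁] [NormedSpace ℂ E₁] [NormedAddCommGroup E₂] [NormedSpace ℂ E₂]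
  (Φ₁ : (ι₁ → ℝ) ≃L[ℝ] E₁) (Φ₂ : (ι₂ → ℝ) ≃L[ℝ] E₂) {g₁ g₂ : ℕ}
  (e₁ : Fin g₁ ⊕ Fin g₁ ≃ ι₁) (e₂ : Fin g₂ ⊕ Fin g₂ ≃ ι₂)

/-- The lattice basis vectors of `X₁ × X₂` coming from `X₁` are `(λ, 0)`. [cite: Lange2023AbelianVarietiesComplex, Cor. 2.4.24] -/
theorem prodPeriod_single_inl (a : ι₁) :
    prodPeriod Φ₁ Φ₂ (Pi.single (Sum.inl a) (1 : ℝ)) = (Φ₁ (Pi.single a 1), 0) := by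
  rw [prodPeriod_apply]
  congr 1
  · congr 1
    funext i
    by_cases h : i = a
    · subst h; simp
    · rw [Pi.single_eq_of_ne h, Pi.single_eq_of_ne (fun h' ↦ h (Sum.inl_injective h'))]
  · have h0 : (fun j : ι₂ ↦ (Pi.single (Sum.inl a) (1 : ℝ) : ι₁ ⊕ ι₂ → ℝ) (Sum.inr j)) = 0 :=
      funext fun j ↦ by rw [Pi.zero_apply]; exact Pi.single_eq_of_ne Sum.inr_ne_inl _
    rw [h0, map_zero]

/-- The lattice basis vectors of `X₁ × X₂` coming from `X₂` are `(0, λ)`. [cite: Lange2023AbelianVarietiesComplex, Cor. 2.4.24] -/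
theorem prodPeriod_single_inr (b : ι₂) :
    prodPeriod Φ₁ Φ₂ (Pi.single (Sum.inr b) (1 : ℝ)) = (0, Φ₂ (Pi.single b 1)) := by
  rw [prodPeriod_apply]
  congr 1
  · have h0 : (fun i : ι₁ ↦ (Pi.single (Sum.inr b) (1 : ℝ) : ι₁ ⊕ ι₂ → ℝ) (Sum.inl i)) = 0 :=
      funext fun i ↦ by rw [Pi.zero_apply]; exact Pi.single_eq_of_ne Sum.inl_ne_inr _
    rw [h0, map_zero]
  · congr 1
    funext j
    by_cases h : j = b
    · subst h; simp
    · rw [Pi.single_eq_of_ne h, Pi.single_eq_of_ne (fun h' ↦ h (Sum.inr_injective h'))]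

omit [DecidableEq ι₁] [DecidableEq ι₂] in
/-- The coordinates of the product: `x_{(a,·)}(v₁, v₂) = x_a(v₁)`. [cite: Lange2023AbelianVarietiesComplex, §1.1.4] -/
theorem coord_prodPeriod_inl (a : ι₁) :
    coord (prodPeriod Φ₁ Φ₂) (Sum.inl a) = (coord Φ₁ a).comp (ContinuousLinearMap.fst ℝ E₁ E₂) := by
  refine ContinuousLinearMap.ext fun v ↦ ?_
  rw [ContinuousLinearMap.comp_apply, coord_apply, coord_apply]
  have hv : v = prodPeriod Φ₁ Φ₂ (Sum.elim (Φ₁.symm v.1) (Φ₂.symm v.2)) := by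
    rw [prodPeriod_apply]; simp
  conv_lhs => rw [hv, ContinuousLinearEquiv.symm_apply_apply]
  rfl

omit [DecidableEq ι₁] [DecidableEq ι₂] in
/-- `x_{(·,b)}(v₁, v₂) = x_b(v₂)`. [cite: Lange2023AbelianVarietiesComplex, §1.1.4] -/
theorem coord_prodPeriod_inr (b : ι₂) :
    coord (prodPeriod Φ₁ Φ₂) (Sum.inr b) = (coord Φ₂ b).comp (ContinuousLinearMap.snd ℝ E₁ E₂) := by
  refine ContinuousLinearMap.ext fun v ↦ ?_
  rw [ContinuousLinearMap.comp_apply, coord_apply, coord_apply]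
  have hv : v = prodPeriod Φ₁ Φ₂ (Sum.elim (Φ₁.symm v.1) (Φ₂.symm v.2)) := by
    rw [prodPeriod_apply]; simp
  conv_lhs => rw [hv, ContinuousLinearEquiv.symm_apply_apply]
  rfl

omit [DecidableEq ι₁] [DecidableEq ι₂] in
/-- **`p₁^*(dx¹_{T-pairs}) = dx_{T-pairs}`**: the pull-back of an interleaved monomial of `X₁` along `p₁` is the
interleaved monomial of the same pairs of the product basis. [cite: Lange2023AbelianVarietiesComplex, §1.1.4 Prop. 1.1.20] -/
theorem latMonomial_ilvWord_compContinuousLinearMap_fst {q : ℕ} (t : Fin q → Fin g₁) :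
    (latMonomial Φ₁ (2 * q) (ilvWord e₁ t)).compContinuousLinearMap (ContinuousLinearMap.fst ℝ E₁ E₂) =
      latMonomial (prodPeriod Φ₁ Φ₂) (2 * q) (ilvWord (prodEnum e₁ e₂) (Fin.castAdd g₂ ∘ t)) := by
  rw [latMonomial_eq, latMonomial_eq, wedgeWord_compContinuousLinearMap, constOfIsEmpty_compContinuousLinearMap]
  have hθ : (fun a : ι₁ ↦ ((coord Φ₁ a).smulRight (1 : ℂ)).comp (ContinuousLinearMap.fst ℝ E₁ E₂)) =
      (fun x : ι₁ ⊕ ι₂ ↦ (coord (prodPeriod Φ₁ Φ₂) x).smulRight (1 : ℂ)) ∘ Sum.inl := by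
    funext a; rw [Function.comp_apply, coord_prodPeriod_inl]; rfl
  -- the word `ilvWord (prodEnum e₁ e₂) (castAdd ∘ t)` is `inl ∘ ilvWord e₁ t`
  have hw : ilvWord (prodEnum e₁ e₂) (Fin.castAdd g₂ ∘ t) = Sum.inl ∘ ilvWord e₁ t := by
    funext m
    rw [ilvWord_apply, Function.comp_apply, ilvWord_apply]
    cases finTwoMulEquivSum q m with
    | inl i => rw [Sum.map_inl, Sum.map_inl, Function.comp_apply, prodEnum_inl_castAdd]
    | inr i => rw [Sum.map_inr, Sum.map_inr, Function.comp_apply, prodEnum_inr_castAdd]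
  rw [hθ, wedgeWord_comp_alphabet, hw]

omit [DecidableEq ι₁] [DecidableEq ι₂] in
/-- **`p₂^*(dx²_{T-pairs}) = dx_{(g₁ + T)-pairs}`**. [cite: Lange2023AbelianVarietiesComplex, §1.1.4 Prop. 1.1.20] -/
theorem latMonomial_ilvWord_compContinuousLinearMap_snd {q : ℕ} (t : Fin q → Fin g₂) :
    (latMonomial Φ₂ (2 * q) (ilvWord e₂ t)).compContinuousLinearMap (ContinuousLinearMap.snd ℝ E₁ E₂) =
      latMonomial (prodPeriod Φ₁ Φ₂) (2 * q) (ilvWord (prodEnum e₁ e₂) (Fin.natAdd g₁ ∘ t)) := by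
  rw [latMonomial_eq, latMonomial_eq, wedgeWord_compContinuousLinearMap, constOfIsEmpty_compContinuousLinearMap]
  have hθ : (fun b : ι₂ ↦ ((coord Φ₂ b).smulRight (1 : ℂ)).comp (ContinuousLinearMap.snd ℝ E₁ E₂)) =
      (fun x : ι₁ ⊕ ι₂ ↦ (coord (prodPeriod Φ₁ Φ₂) x).smulRight (1 : ℂ)) ∘ Sum.inr := by
    funext b; rw [Function.comp_apply, coord_prodPeriod_inr]; rfl
  have hw : ilvWord (prodEnum e₁ e₂) (Fin.natAdd g₁ ∘ t) = Sum.inr ∘ ilvWord e₂ t := by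
    funext m
    rw [ilvWord_apply, Function.comp_apply, ilvWord_apply]
    cases finTwoMulEquivSum q m with
    | inl i => rw [Sum.map_inl, Sum.map_inl, Function.comp_apply, prodEnum_inl_natAdd]
    | inr i => rw [Sum.map_inr, Sum.map_inr, Function.comp_apply, prodEnum_inr_natAdd]
  rw [hθ, wedgeWord_comp_alphabet, hw]

omit [DecidableEq ι₁] [DecidableEq ι₂] in
/-- `p₁^* ω¹_a = ω_{castAdd a}` for the pair forms. [cite: Lange2023AbelianVarietiesComplex, §1.1.4 Prop. 1.1.20] -/
theorem pairMonomial_compContinuousLinearMap_fst (a : Fin g₁) :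
    (pairMonomial Φ₁ e₁ a).compContinuousLinearMap (ContinuousLinearMap.fst ℝ E₁ E₂) =
      pairMonomial (prodPeriod Φ₁ Φ₂) (prodEnum e₁ e₂) (Fin.castAdd g₂ a) :=
  latMonomial_ilvWord_compContinuousLinearMap_fst Φ₁ Φ₂ e₁ e₂ fun _ : Fin 1 ↦ a

omit [DecidableEq ι₁] [DecidableEq ι₂] in
/-- `p₂^* ω²_b = ω_{g₁ + b}` for the pair forms. [cite: Lange2023AbelianVarietiesComplex, §1.1.4 Prop. 1.1.20] -/
theorem pairMonomial_compContinuousLinearMap_snd (b : Fin g₂) :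
    (pairMonomial Φ₂ e₂ b).compContinuousLinearMap (ContinuousLinearMap.snd ℝ E₁ E₂) =
      pairMonomial (prodPeriod Φ₁ Φ₂) (prodEnum e₁ e₂) (Fin.natAdd g₁ b) :=
  latMonomial_ilvWord_compContinuousLinearMap_snd Φ₁ Φ₂ e₁ e₂ fun _ : Fin 1 ↦ b

variable {η₁ : E₁ [⋀^Fin 2]→L[ℝ] ℝ} {η₂ : E₂ [⋀^Fin 2]→L[ℝ] ℝ} {d₁ : Fin g₁ → ℕ} {d₂ : Fin g₂ → ℕ}

/-- **The concatenation of symplectic bases of `(X₁, η₁)` and `(X₂, η₂)` is a symplectic basis of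
`(X₁ × X₂, p₁^*η₁ + p₂^*η₂)` of type `(d¹, d²)`** whenever the concatenated type is again a divisibility chain (e.g.
for principal polarisations: `IsSymplecticEnum.prod_of_principal`). [cite: Lange2023AbelianVarietiesComplex, Cor. 2.4.24 (`p₁^*L₁ ⊗ p₂^*L₂` is a polarization with hermitian form `H₁ ⊕ H₂`)] [cite: Bertrand1997DualityTori, §3 (b) (p. 213)] -/
theorem IsSymplecticEnum.prod (h₁ : IsSymplecticEnum Φ₁ e₁ η₁ d₁) (h₂ : IsSymplecticEnum Φ₂ e₂ η₂ d₂)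
    (hd : ∀ i j, i ≤ j → Fin.append d₁ d₂ i ∣ Fin.append d₁ d₂ j) :
    IsSymplecticEnum (prodPeriod Φ₁ Φ₂) (prodEnum e₁ e₂) (prodForm η₁ η₂) (Fin.append d₁ d₂) := by
  refine ⟨hd, fun i j ↦ ?_, fun i j ↦ ?_, fun i j ↦ ?_⟩
  · refine Fin.addCases (fun a ↦ ?_) (fun b ↦ ?_) i <;> refine Fin.addCases (fun a' ↦ ?_) (fun b' ↦ ?_) j
    · rw [prodEnum_inl_castAdd, prodEnum_inl_castAdd, prodPeriod_single_inl, prodPeriod_single_inl, prodForm_apply,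
        h₁.left_left, twoForm_zero_left', add_zero]
    · rw [prodEnum_inl_castAdd, prodEnum_inl_natAdd, prodPeriod_single_inl, prodPeriod_single_inr, prodForm_apply,
        twoForm_zero_right', twoForm_zero_left', add_zero]
    · rw [prodEnum_inl_natAdd, prodEnum_inl_castAdd, prodPeriod_single_inr, prodPeriod_single_inl, prodForm_apply,
        twoForm_zero_left', twoForm_zero_right', add_zero]
    · rw [prodEnum_inl_natAdd, prodEnum_inl_natAdd, prodPeriod_single_inr, prodPeriod_single_inr, prodForm_apply,
        h₂.left_left, twoForm_zero_left', zero_add]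
  · refine Fin.addCases (fun a ↦ ?_) (fun b ↦ ?_) i <;> refine Fin.addCases (fun a' ↦ ?_) (fun b' ↦ ?_) j
    · rw [prodEnum_inr_castAdd, prodEnum_inr_castAdd, prodPeriod_single_inl, prodPeriod_single_inl, prodForm_apply,
        h₁.right_right, twoForm_zero_left', add_zero]
    · rw [prodEnum_inr_castAdd, prodEnum_inr_natAdd, prodPeriod_single_inl, prodPeriod_single_inr, prodForm_apply,
        twoForm_zero_right', twoForm_zero_left', add_zero]
    · rw [prodEnum_inr_natAdd, prodEnum_inr_castAdd, prodPeriod_single_inr, prodPeriod_single_inl, prodForm_apply,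
        twoForm_zero_left', twoForm_zero_right', add_zero]
    · rw [prodEnum_inr_natAdd, prodEnum_inr_natAdd, prodPeriod_single_inr, prodPeriod_single_inr, prodForm_apply,
        h₂.right_right, twoForm_zero_left', zero_add]
  · refine Fin.addCases (fun a ↦ ?_) (fun b ↦ ?_) i <;> refine Fin.addCases (fun a' ↦ ?_) (fun b' ↦ ?_) j
    · rw [prodEnum_inl_castAdd, prodEnum_inr_castAdd, prodPeriod_single_inl, prodPeriod_single_inl, prodForm_apply,
        h₁.left_right, twoForm_zero_left', add_zero, Fin.append_left]
      simp only [Fin.castAdd_inj]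
    · have hne : Fin.castAdd g₂ a ≠ Fin.natAdd g₁ b' := fun h ↦ by
        have h' := congrArg Fin.val h
        simp only [Fin.val_castAdd, Fin.val_natAdd] at h'
        omega
      rw [prodEnum_inl_castAdd, prodEnum_inr_natAdd, prodPeriod_single_inl, prodPeriod_single_inr, prodForm_apply,
        twoForm_zero_right', twoForm_zero_left', add_zero, if_neg hne]
    · have hne : Fin.natAdd g₁ b ≠ Fin.castAdd g₂ a' := fun h ↦ by
        have h' := congrArg Fin.val h
        simp only [Fin.val_castAdd, Fin.val_natAdd] at h'
        omega
      rw [prodEnum_inl_natAdd, prodEnum_inr_castAdd, prodPeriod_single_inr, prodPeriod_single_inl, prodForm_apply,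
        twoForm_zero_left', twoForm_zero_right', add_zero, if_neg hne]
    · rw [prodEnum_inl_natAdd, prodEnum_inr_natAdd, prodPeriod_single_inr, prodPeriod_single_inr, prodForm_apply,
        h₂.left_right, twoForm_zero_left', zero_add, Fin.append_right]
      simp only [Fin.natAdd_inj]

/-- **Principal factors**: two PRINCIPAL symplectic bases concatenate to a principal symplectic basis of the product
(type `(1, …, 1)`; `(A, λ) = (C₁, λ₁) × (C₂, λ₂)` principally polarised, as in Bertrand's Corollary).
[cite: Bertrand1997DualityTori, §3 (b) Corollary (p. 214)] [cite: Lange2023AbelianVarietiesComplex, Cor. 2.4.24] -/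
theorem IsSymplecticEnum.prod_of_principal (h₁ : IsSymplecticEnum Φ₁ e₁ η₁ fun _ ↦ 1)
    (h₂ : IsSymplecticEnum Φ₂ e₂ η₂ fun _ ↦ 1) :
    IsSymplecticEnum (prodPeriod Φ₁ Φ₂) (prodEnum e₁ e₂) (prodForm η₁ η₂) fun _ ↦ 1 := by
  have h := h₁.prod Φ₁ Φ₂ e₁ e₂ h₂ (fun i j _ ↦ by rw [append_one_one])
  rwa [append_one_one] at h

omit [DecidableEq ι₂] in
/-- **The block form of the first factor is the pulled-back polarisation form: `θ_{false} = p₁^*E₁`** (for the product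
symplectic basis of types `d¹`, `d²`; `E₁ = ofRealForm η₁`). [cite: Bertrand1997DualityTori, §3 (b) (p. 213: "`λ = p₁^*λ₁ + ⋯ + p_n^*λ_n`, where `p_i` is the projection from `A` to `C_i`")] [cite: Lange2023AbelianVarietiesComplex, Cor. 2.4.24] -/
theorem IsSymplecticEnum.blockTwoForm_prod_false (h₁ : IsSymplecticEnum Φ₁ e₁ η₁ d₁) :
    blockTwoForm (prodPeriod Φ₁ Φ₂) (prodEnum e₁ e₂) (Fin.append d₁ d₂) (prodBlock g₁ g₂) false =
      ofRealForm (η₁.compContinuousLinearMap (ContinuousLinearMap.fst ℝ E₁ E₂)) := by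
  rw [ofRealForm_compContinuousLinearMap, h₁.ofRealForm_eq_sum_pairMonomial Φ₁ e₁ d₁, blockTwoForm,
    ← Equiv.sum_comp (finSumFinEquiv : Fin g₁ ⊕ Fin g₂ ≃ Fin (g₁ + g₂)), Fintype.sum_sum_type]
  simp only [finSumFinEquiv_apply_left, finSumFinEquiv_apply_right, prodBlock_castAdd, prodBlock_natAdd,
    Fin.append_left, if_true, Bool.true_eq_false, if_false]
  have hz : ∑ x : Fin g₂, (0 : ℂ) • pairMonomial (prodPeriod Φ₁ Φ₂) (prodEnum e₁ e₂) (Fin.natAdd g₁ x) = 0 :=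
    Finset.sum_eq_zero fun x _ ↦ by ext v; simp
  have hlin : (∑ ν, ((d₁ ν : ℕ) : ℂ) • pairMonomial Φ₁ e₁ ν).compContinuousLinearMap (ContinuousLinearMap.fst ℝ E₁ E₂) =
      ∑ ν, ((d₁ ν : ℕ) : ℂ) • (pairMonomial Φ₁ e₁ ν).compContinuousLinearMap (ContinuousLinearMap.fst ℝ E₁ E₂) := by
    ext v
    simp [ContinuousAlternatingMap.sum_apply]
  rw [hz, add_zero, hlin]
  exact Finset.sum_congr rfl fun ν _ ↦ by rw [pairMonomial_compContinuousLinearMap_fst Φ₁ Φ₂ e₁ e₂ ν]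

omit [DecidableEq ι₁] in
/-- **The block form of the second factor: `θ_{true} = p₂^*E₂`.** [cite: Bertrand1997DualityTori, §3 (b) (p. 213)] [cite: Lange2023AbelianVarietiesComplex, Cor. 2.4.24] -/
theorem IsSymplecticEnum.blockTwoForm_prod_true (h₂ : IsSymplecticEnum Φ₂ e₂ η₂ d₂) :
    blockTwoForm (prodPeriod Φ₁ Φ₂) (prodEnum e₁ e₂) (Fin.append d₁ d₂) (prodBlock g₁ g₂) true =
      ofRealForm (η₂.compContinuousLinearMap (ContinuousLinearMap.snd ℝ E₁ E₂)) := by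
  rw [ofRealForm_compContinuousLinearMap, h₂.ofRealForm_eq_sum_pairMonomial Φ₂ e₂ d₂, blockTwoForm,
    ← Equiv.sum_comp (finSumFinEquiv : Fin g₁ ⊕ Fin g₂ ≃ Fin (g₁ + g₂)), Fintype.sum_sum_type]
  simp only [finSumFinEquiv_apply_left, finSumFinEquiv_apply_right, prodBlock_castAdd, prodBlock_natAdd,
    Fin.append_right, if_true, Bool.false_eq_true, if_false]
  have hz : ∑ x : Fin g₁, (0 : ℂ) • pairMonomial (prodPeriod Φ₁ Φ₂) (prodEnum e₁ e₂) (Fin.castAdd g₂ x) = 0 :=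
    Finset.sum_eq_zero fun x _ ↦ by ext v; simp
  have hlin : (∑ ν, ((d₂ ν : ℕ) : ℂ) • pairMonomial Φ₂ e₂ ν).compContinuousLinearMap (ContinuousLinearMap.snd ℝ E₁ E₂) =
      ∑ ν, ((d₂ ν : ℕ) : ℂ) • (pairMonomial Φ₂ e₂ ν).compContinuousLinearMap (ContinuousLinearMap.snd ℝ E₁ E₂) := by
    ext v
    simp [ContinuousAlternatingMap.sum_apply]
  rw [hz, zero_add, hlin]
  exact Finset.sum_congr rfl fun ν _ ↦ by rw [pairMonomial_compContinuousLinearMap_snd Φ₁ Φ₂ e₁ e₂ ν]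

omit [DecidableEq ι₂] in
/-- Principal factors: `θ_{false} = p₁^*E₁` for the type `(1, …, 1)`. [cite: Bertrand1997DualityTori, §3 (b) (p. 213)] -/
theorem IsSymplecticEnum.blockTwoForm_prod_false_of_principal (h₁ : IsSymplecticEnum Φ₁ e₁ η₁ fun _ ↦ 1) :
    blockTwoForm (prodPeriod Φ₁ Φ₂) (prodEnum e₁ e₂) (fun _ ↦ 1) (prodBlock g₁ g₂) false =
      ofRealForm (η₁.compContinuousLinearMap (ContinuousLinearMap.fst ℝ E₁ E₂)) := by
  rw [← h₁.blockTwoForm_prod_false Φ₁ Φ₂ e₁ e₂ (d₂ := fun _ ↦ 1), append_one_one]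

omit [DecidableEq ι₁] in
/-- Principal factors: `θ_{true} = p₂^*E₂` for the type `(1, …, 1)`. [cite: Bertrand1997DualityTori, §3 (b) (p. 213)] -/
theorem IsSymplecticEnum.blockTwoForm_prod_true_of_principal (h₂ : IsSymplecticEnum Φ₂ e₂ η₂ fun _ ↦ 1) :
    blockTwoForm (prodPeriod Φ₁ Φ₂) (prodEnum e₁ e₂) (fun _ ↦ 1) (prodBlock g₁ g₂) true =
      ofRealForm (η₂.compContinuousLinearMap (ContinuousLinearMap.snd ℝ E₁ E₂)) := by
  rw [← h₂.blockTwoForm_prod_true Φ₁ Φ₂ e₁ e₂ (d₁ := fun _ ↦ 1), append_one_one]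

/-- **Bertrand's Corollary for `(A, λ) = (C₁, λ₁) × (C₂, λ₂)`, on forms, for every cycle**: for principally polarised
tori `(X₁, η₁)`, `(X₂, η₂)` with principal symplectic bases, words `c : Fin q → Bool`, `c′ : Fin p → Bool` with
complementary multiplicities `r_false + r′_false = g₁ = dim X₁`, `r_true + r′_true = g₂ = dim X₂` (`p + q = g₁ + g₂`),
and every `σ ∈ H_{2q}(X₁ × X₂, ℤ)`:
`J! · ∫_{X₁×X₂} ch^{c′} ∧ η♭(σ) = J′! · ∫_σ ch^{c}`, where the factors of `ch^{c}` are `c₁(p₁^*L₁) = -p₁^*E₁`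
(`blockTwoForm … false`, `IsSymplecticEnum.blockTwoForm_prod_false_of_principal`) and `c₁(p₂^*L₂) = -p₂^*E₂` — i.e.
"`deg_J(B)/r₁! r₂! = deg_{J′}(B^⊥)/r′₁! r′₂!`" for `σ = [B]`. [cite: Bertrand1997DualityTori, §3 (b) Corollary (p. 214)] -/
theorem IsSymplecticEnum.prod_factorial_mul_torusIntegral_chern_wedge_polFlat_prod
    (h₁ : IsSymplecticEnum Φ₁ e₁ η₁ fun _ ↦ 1) (h₂ : IsSymplecticEnum Φ₂ e₂ η₂ fun _ ↦ 1)
    (hp₁ : IsPrincipalPolarization Φ₁ η₁) (hp₂ : IsPrincipalPolarization Φ₂ η₂) {p q : ℕ} (hm : q + p = g₁ + g₂)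
    (e : Fin (2 * p + 2 * q) ≃ ι₁ ⊕ ι₂) {c : Fin q → Bool} {c' : Fin p → Bool}
    (hfalse : wordMult c false + wordMult c' false = g₁) (htrue : wordMult c true + wordMult c' true = g₂)
    (σ : ⋀[ℤ]^(2 * q) (ι₁ ⊕ ι₂ → ℤ)) :
    (∏ i, ((wordMult c i).factorial : ℂ)) *
        torusIntegral (prodPeriod Φ₁ Φ₂) e ((wedgeFamily p fun j ↦
          -blockTwoForm (prodPeriod Φ₁ Φ₂) (prodEnum e₁ e₂) (fun _ ↦ 1) (prodBlock g₁ g₂) (c' j)).wedge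
            (polFlat (prodPeriod Φ₁ Φ₂) (prodForm η₁ η₂) (2 * q) σ)) =
      (∏ i, ((wordMult c' i).factorial : ℂ)) *
        cycleIntegral (prodPeriod Φ₁ Φ₂) (2 * q) σ (wedgeFamily q fun j ↦
          -blockTwoForm (prodPeriod Φ₁ Φ₂) (prodEnum e₁ e₂) (fun _ ↦ 1) (prodBlock g₁ g₂) (c j)) := by
  letI : LinearOrder (ι₁ ⊕ ι₂) := linearOrderOfOrientation e
  obtain ⟨G, hG⟩ := exists_intMatrix_latticeGram (prodPeriod Φ₁ Φ₂) (prodForm η₁ η₂)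
    (hp₁.prod hp₂).isRiemannForm.2.1
  have hm' : q + p = Fintype.card (Fin (g₁ + g₂)) := by rw [Fintype.card_fin]; exact hm
  refine (h₁.prod_of_principal Φ₁ Φ₂ e₁ e₂ h₂).prod_factorial_mul_torusIntegral_chern_wedge_polFlat_of_principal
    (prodPeriod Φ₁ Φ₂) (hp₁.prod hp₂) hG hm' e (prodBlock g₁ g₂) (fun i ↦ ?_) σ
  cases i
  · rw [card_filter_prodBlock_false]; exact hfalse
  · rw [card_filter_prodBlock_true]; exact htrue

end ProductTorus






end ComplexTorus

end Literature.Geometry.Kaehler
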